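import Summits.CriticalPhenomena.PercolationContinuityZ3.Theses.PercNearOneGluing
import Literature.Probability.LatticeModels.ProdBernoulliIndependence
import Literature.Probability.Percolation.Crossings
import Literature.Probability.Percolation.PlanarDuality

/-!
# Disproof of `NearOneGluing` (crux `stmt-CriticalPhenomena-4574`) — standing adversary's work file

`NearOneGluing` is Kozma–Nitzan's Conjecture 3 (arXiv:2401.12397, p.15) typed over all finite
weighted graphs: `∀ ε > 0 ∃ δ > 0 ∀ n w A o b, P(o ↔ A) > 1-δ → (∀ a ∈ A, P(a ↔ b) > 1-δ) →
P(o ↔ b) > 1-ε`, with `P = prodBernoulli w` on `Set (Sym2 (Fin n))` and `↔ = openConn`.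

## Findings (index; every `theorem` below is sorry-free unless its docstring says NEAR-MISS)

* §1 Toolkit: `openConn_self`, `openConn_trans`, `prodBernoulli_zero` (all weights 0 = point mass
  at `∅`), `real_openConn_zero`.
* §2 LOAD-BEARING hypotheses ("any proof must use H"):
  `nearOneGluing_false_without_relay` (drop `P(o ↔ A) > 1-δ`),
  `nearOneGluing_false_without_reliability` (drop `∀ a ∈ A, P(a ↔ b) > 1-δ`),
  `nearOneGluing_false_with_some_reliable` (weaken `∀ a ∈ A` to `∃ a ∈ A`).
  All three witnesses live on `Fin 2` with zero weights.
* §3 WHAT IS NOT LOAD-BEARING — the statement is TRUE for bounded relay sets: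
  `nearOneGluing_of_card_le k` gives `δ = ε/(k+1)` for `|A| ≤ k` by the union bound
  `{o ↮ b} ⊆ {o ↮ A} ∪ ⋃_{a∈A} {a ↮ b}` (no FKG); `nearOneGluing_singleton` (`δ = ε/2`).
  Hence the ENTIRE content of the crux is uniformity in `|A|`.
* §4 HARRIS REDUCTION (the one general-graph tool): `real_compl_openConn_le_harris`
  (`P(o ↮ b) ≤ P(o ↮ A) + Σ_a P(o ↔ a) P(a ↮ b)`) and `nearOneGluing_of_mean_le K`
  (`δ = ε/(K+1)` whenever `Σ_{a∈A} P(o ↔ a) ≤ K`).  So a counterexample FAMILY needs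
  `E|C(o) ∩ A| = Σ_a P(o ↔ a) > ε/δ - 1 → ∞` together with `P(o ↮ b) ≥ ε`: a heavy LOWER tail of
  `N = |C(o) ∩ A|` ("pocket with few fingers"; engine item stmt-4575).
* §5 EXACT small model (path `0 – 1 – 2`, both edges weight `p`): `real_openConn02_path = p²`,
  `real_openConn01_path = real_openConn12_path = p`.  Consequences:
  `not_nearOneGluingLossless` — the strengthening `δ = ε` is FALSE (`p = 7/10`, `ε = 1/2`);
  `unionBound_rate_sharp` — for `|A| = 1` no rate `δ = c ε` with `c > 1/2` works, so §3's
  `ε/2` is sharp; whether `δ = ε/2` works for EVERY `|A|` is exactly AdditiveGluing (stmt-4576).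
* §7 VERTEX DELETION (C8) `real_offConn_compl_mul_le`: `P(a ↮ b avoiding o)·P(o ↮ b) ≤ P(a ↮ b)`
  and its set form `real_openConnIn_compl_mul_le` (`P(a ↮ b avoiding X)·P(X ↮ b) ≤ P(a ↮ b)`)
  (Harris on two decreasing events) ⇒ in a counterexample every relay is `(δ/ε)`-reliable in
  `G − o`; and `nearOneGluing_depth_one`: if every positive-weight neighbour of `o` is a relay
  (KN's "0 isolated in G ∖ A") the crux HOLDS with `δ = ε²/4` (conditioning on the star of `o`,
  cylinder/independence bookkeeping done in full).  Counterexamples need depth ≥ 2.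
* §9 POCKET DECOMPOSITION (C6–C7 formal): `pocketEq A o W = {C_U(o) = W}` (relay-free pocket),
  `determinedBy_pocketEq` (pocket pairs), `determinedBy_linkEq` (W–A pairs), `pocket_bad_subset`
  (on the bad event some relay is linked and every linked relay fails avoiding W),
  `pocket_bad_le` (3-way disjoint-support independence + link-cylinder partition),
  `pocket_bad_mul_le : P(C_U(o)=W, bad)·P(W ↮ b) ≤ δ·P(C_U(o)=W)` and the global
  `bad_unreliablePocket_le : P(bad, P(C_U(o) ↮ b) ≥ r) ≤ δ/r` — the bad event lives on
  RELIABLE relay-free pockets; `pocket_bad_le_sqrt`, `bad_le_sum_sqrt` (Rényi-½ ENTROPY BOUND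
  `P(bad) ≤ √δ · Σ_W √P(C_U(o)=W)`) and `bad_sq_le_card_support` (`P(bad)² ≤ δ · #pockets`):
  the residual crux is exactly an entropy bound for reliable relay-free pockets.
* §8 NORMAL FORM `nearOneGluing_iff_saturated`: WLOG `A = relSet w b δ` (all δ-reliable vertices),
  one hypothesis; so a counterexample's non-relays are all δ-unreliable.
* §6 (module docstring at the end) WHY IT RESISTS — informal, checked by hand: every natural
  gadget class tried (stars / hubs / `K_{2,M}` with a hub / spines and chains / spherically
  symmetric trees / near-sure lattices / disjoint petals or tentacles glued at `o` / ghost-field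
  reliability) satisfies the crux with `P(o ↮ b) = O(δ log(1/δ))`; the obstruction is always the
  same: Harris makes `{o ↔ a}` and `{a ↮ b}` non-positively correlated for EACH `a`, so the bad
  event needs ≥ ε/δ near-disjoint "directions", and any mechanism making a relay reliable either
  merges relays into a bounded effective set or decouples their failures from `o`'s access.
  Certified numerical search over all weightings of `K_n`, `n ≤ 9` (kit jobs j005065/j005066,
  objectives F, G = AdditiveGluing slack, KN ratios R1, R2) is recorded in NOTES/evidence.

Cross-references (other units on this crux, read 2026-08-15T22:50Z): cdisprove-4575's Disproof.lean proves
`NoHeavyLowerTail ↔ NearOneGluing` (iff_nearOneGluing) and `KN Conj 1 ⇒ linear form (C = 3) ⇒ X`; ideator cards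
`Cruxes/NearOneGluing/Ideas/{bhk-dyadic-thinning, independent-bad-world, sentinel-duality}.md` — in particular
bhk-dyadic-thinning claims (modulo vendoring van den Berg–Häggström–Kahn 2006) the |A|-free SINGLE-FINGER lemma
`P(|C(o) ∩ A'| = 1, o ↮ b) ≤ max_{a∈A'} P(a ↮ b)` (my random exact checks on n ≤ 6, graphs and 3-uniform hypergraphs:
0 violations in 9500 instances, local/sf_probe.py) and hence `P(o ↮ b) ≤ P(o ↮ A) + 16(1+log₂|A|)·max_a P(a ↮ b)`:
a counterexample at (ε, δ) would need `|A| ≥ 2^{ε/(16δ)-2}` and a harmonic footprint law `P(N = n, bad) ≈ δ/n` —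
consistent with, and sharper than, the O(δ log) losses of every family in §6.

LANDED IN-TREE SINCE (lead prover-line-stmt-CriticalPhenomena-4574-0, 2026-08-16, Theorems/PercNearOneGluingNearOneGluing*.lean):
logGluing / windowBound / nearOneGluing_of_card_lt_two_pow (p72363, BHK-based: `P(o ↮ b) ≤ P(o ↮ A) + 16(1+log₂|A|) max_a P(a ↮ b)`),
depthOneGluing (p73927, KN Thm 4 in additive form ⊇ §7's depth_one), pocketBound (+Aux, p74619/p74223 ≈ §9's kernel),
nearOneGluing_of_pocketSupport (p73366), freshPocketAveraging (p73580), multiCopyFootprint (p73463), knLemma3i (p73538), singleFinger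
(p71973), bhkLogSupermodular / bhkClusterAssociation / terminalSeparation (p71992/p71998/p72214).  Provers should cite THOSE; this file
keeps the adversary's self-contained versions (different proofs: first-exit/determinedBy route) plus the entropy forms of §9, which are
not in the tree.  Both registered lines are `line-dead` at crux-equivalent residuals (stub_doomWindow, stub_giantPocketsRare) — see the
`Targets` section at the end of this file.  Obstruction-side: Cruxes/NearOneGluing/BarrierSharedBit.md (Conj 3 FAILS in the shared-bit
hypercube model; a bond counterexample must simulate shared bits, which BK forbids for disjoint edges) sharpens §6 (C5).

Namespace of the crux: `Summit.CriticalPhenomena.PercolationContinuityZ3.Theses.PercNearOneGluing`.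
-/

namespace Summit.CriticalPhenomena.PercolationContinuityZ3.Cruxes.NearOneGluing.Disproof

open MeasureTheory ProbabilityTheory
open Literature.Probability.LatticeModels Literature.Probability.Percolation
open Summit.CriticalPhenomena.PercolationContinuityZ3.Theses.PercNearOneGluing (NearOneGluing)

/-! ## §1 Toolkit -/

section Toolkit

variable {V : Type*}

/-- `{x ↔ x}` is the sure event. [folklore] -/
theorem openConn_self (x : V) : (openConn x x : Set (BondConfig V)) = Set.univ :=
  Set.eq_univ_of_forall fun _ => SimpleGraph.Reachable.refl _

/-- Gluing at a shared vertex: `{x ↔ y} ∩ {y ↔ z} ⊆ {x ↔ z}`. [folklore] -/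
theorem openConn_trans {x y z : V} {ω : BondConfig V} (h1 : ω ∈ openConn x y)
    (h2 : ω ∈ openConn y z) : ω ∈ openConn x z :=
  SimpleGraph.Reachable.trans h1 h2

/-- In the empty configuration distinct vertices are not connected. [folklore] -/
theorem empty_notMem_openConn {x y : V} (h : x ≠ y) : (∅ : BondConfig V) ∉ openConn x y := by
  intro hr
  change (openGraph (∅ : BondConfig V)).Reachable x y at hr
  rw [openGraph, SimpleGraph.fromEdgeSet_empty, SimpleGraph.reachable_bot] at hr
  exact h hr

/-- All weights zero: `prodBernoulli 0` is the point mass at the empty configuration. [folklore] -/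
theorem prodBernoulli_zero (ι : Type*) :
    prodBernoulli (fun _ : ι => (0 : unitInterval)) = Measure.dirac ∅ := by
  rw [prodBernoulli_const, setBernoulli_zero]

/-- With all weights zero, `P(x ↔ y) = 0` for `x ≠ y`. [folklore] -/
theorem real_openConn_zero {n : ℕ} {x y : Fin n} (h : x ≠ y) :
    (prodBernoulli (fun _ : Sym2 (Fin n) => (0 : unitInterval))).real (openConn x y) = 0 := by
  rw [prodBernoulli_zero, measureReal_def, Measure.dirac_apply,
    Set.indicator_of_notMem (empty_notMem_openConn h)]
  simp

end Toolkit

/-! ## §2 Load-bearing hypotheses -/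

/-- `NearOneGluing` with the RELAY hypothesis `P(o ↔ A) > 1 - δ` dropped. -/
def NearOneGluingWithoutRelay : Prop :=
  ∀ ε : ℝ, 0 < ε → ∃ δ : ℝ, 0 < δ ∧ ∀ (n : ℕ) (w : Sym2 (Fin n) → unitInterval)
    (A : Finset (Fin n)) (o b : Fin n),
    (∀ a ∈ A, 1 - δ < (prodBernoulli w).real (openConn a b)) →
      1 - ε < (prodBernoulli w).real (openConn o b)

/-- Any proof must use the relay hypothesis: without it the statement fails already on two
vertices with no open edge, `A = {b}` (a perfectly reliable, nonempty relay set), `ε = 1/2`.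
[folklore] -/
theorem nearOneGluing_false_without_relay : ¬ NearOneGluingWithoutRelay := by
  intro h
  obtain ⟨δ, hδ, h⟩ := h (1 / 2) (by norm_num)
  have key := h 2 (fun _ => 0) {1} 0 1 (by
    intro a ha
    rw [Finset.mem_singleton] at ha
    subst ha
    rw [openConn_self, probReal_univ]
    linarith)
  rw [real_openConn_zero (by decide)] at key
  linarith

/-- `NearOneGluing` with the RELIABILITY hypothesis `∀ a ∈ A, P(a ↔ b) > 1 - δ` dropped. -/
def NearOneGluingWithoutReliability : Prop :=
  ∀ ε : ℝ, 0 < ε → ∃ δ : ℝ, 0 < δ ∧ ∀ (n : ℕ) (w : Sym2 (Fin n) → unitInterval)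
    (A : Finset (Fin n)) (o b : Fin n),
    1 - δ < (prodBernoulli w).real (⋃ a ∈ A, openConn o a) →
      1 - ε < (prodBernoulli w).real (openConn o b)

/-- Any proof must use the reliability hypothesis: without it, two vertices with no open edge,
`A = {o}` (so `P(o ↔ A) = 1`), `ε = 1/2`. [folklore] -/
theorem nearOneGluing_false_without_reliability : ¬ NearOneGluingWithoutReliability := by
  intro h
  obtain ⟨δ, hδ, h⟩ := h (1 / 2) (by norm_num)
  have key := h 2 (fun _ => 0) {0} 0 1 (by
    rw [Finset.set_biUnion_singleton, openConn_self, probReal_univ]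
    linarith)
  rw [real_openConn_zero (by decide)] at key
  linarith

/-- `NearOneGluing` with reliability required of SOME relay vertex only (`∃ a ∈ A` in place of
`∀ a ∈ A`). -/
def NearOneGluingWithSomeReliable : Prop :=
  ∀ ε : ℝ, 0 < ε → ∃ δ : ℝ, 0 < δ ∧ ∀ (n : ℕ) (w : Sym2 (Fin n) → unitInterval)
    (A : Finset (Fin n)) (o b : Fin n),
    1 - δ < (prodBernoulli w).real (⋃ a ∈ A, openConn o a) →
      (∃ a ∈ A, 1 - δ < (prodBernoulli w).real (openConn a b)) →
        1 - ε < (prodBernoulli w).real (openConn o b)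

/-- Reliability of EVERY relay vertex is load-bearing: with `A = {o, b}` on two vertices and no
open edge, `o` reaches `A` surely (at `o`) and some relay (`b`) reaches `b` surely, yet
`P(o ↔ b) = 0`. [folklore] -/
theorem nearOneGluing_false_with_some_reliable : ¬ NearOneGluingWithSomeReliable := by
  intro h
  obtain ⟨δ, hδ, h⟩ := h (1 / 2) (by norm_num)
  have hU : (⋃ a ∈ ({0, 1} : Finset (Fin 2)), (openConn (0 : Fin 2) a : Set (BondConfig (Fin 2))))
      = Set.univ := by
    apply Set.eq_univ_of_forall
    intro ω
    exact Set.mem_iUnion₂.2 ⟨0, by simp, by rw [openConn_self]; trivial⟩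
  have key := h 2 (fun _ => 0) {0, 1} 0 1 (by rw [hU, probReal_univ]; linarith)
    ⟨1, by simp, by rw [openConn_self, probReal_univ]; linarith⟩
  rw [real_openConn_zero (by decide)] at key
  linarith

/-! ## §3 Not load-bearing: bounded relay sets (the union bound) -/

/-- **`NearOneGluing` holds for relay sets of bounded size**, with the explicit linear dependence
`δ = ε / (k+1)` for `|A| ≤ k`: `{o ↮ b} ⊆ {o ↮ A} ∪ ⋃_{a ∈ A} {a ↮ b}` (if `o ↔ a` and `a ↔ b`
then `o ↔ b`), then subadditivity. No correlation inequality is used. Consequently the crux is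
EXACTLY the assertion that `δ` can be taken independent of `|A|` (Kozma–Nitzan 2024, remark
after Conjecture 3; route file: "for bounded |A| it is the union bound"). [folklore] -/
theorem nearOneGluing_of_card_le (k : ℕ) :
    ∀ ε : ℝ, 0 < ε → ∃ δ : ℝ, 0 < δ ∧ ∀ (n : ℕ) (w : Sym2 (Fin n) → unitInterval)
      (A : Finset (Fin n)) (o b : Fin n), A.card ≤ k →
      1 - δ < (prodBernoulli w).real (⋃ a ∈ A, openConn o a) →
      (∀ a ∈ A, 1 - δ < (prodBernoulli w).real (openConn a b)) →
      1 - ε < (prodBernoulli w).real (openConn o b) := by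
  intro ε hε
  refine ⟨ε / (k + 1), by positivity, ?_⟩
  intro n w A o b hk hA hab
  set μ := prodBernoulli w with hμ
  have hsub : (openConn o b : Set (BondConfig (Fin n)))ᶜ ⊆
      (⋃ a ∈ A, openConn o a)ᶜ ∪ ⋃ a ∈ A, (openConn a b)ᶜ := by
    intro ω hω
    by_cases h1 : ω ∈ ⋃ a ∈ A, (openConn o a : Set (BondConfig (Fin n)))
    · right
      obtain ⟨a, ha, hoa⟩ := Set.mem_iUnion₂.1 h1
      exact Set.mem_iUnion₂.2 ⟨a, ha, fun hab' => hω (openConn_trans hoa hab')⟩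
    · left
      exact h1
  have h1 : μ.real (openConn o b)ᶜ ≤
      μ.real (⋃ a ∈ A, openConn o a)ᶜ + ∑ a ∈ A, μ.real (openConn a b)ᶜ :=
    calc μ.real (openConn o b)ᶜ
        ≤ μ.real ((⋃ a ∈ A, openConn o a)ᶜ ∪ ⋃ a ∈ A, (openConn a b)ᶜ) :=
          measureReal_mono hsub
      _ ≤ μ.real (⋃ a ∈ A, openConn o a)ᶜ + μ.real (⋃ a ∈ A, (openConn a b)ᶜ) :=
          measureReal_union_le _ _
      _ ≤ μ.real (⋃ a ∈ A, openConn o a)ᶜ + ∑ a ∈ A, μ.real (openConn a b)ᶜ := by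
          gcongr
          exact measureReal_biUnion_finset_le _ _
  simp only [probReal_compl_eq_one_sub MeasurableSet.of_discrete] at h1
  have h2 : ∑ a ∈ A, (1 - μ.real (openConn a b)) ≤ A.card * (ε / (k + 1)) := by
    calc ∑ a ∈ A, (1 - μ.real (openConn a b)) ≤ ∑ a ∈ A, ε / (k + 1) :=
          Finset.sum_le_sum fun a ha => by linarith [hab a ha]
      _ = A.card * (ε / (k + 1)) := by rw [Finset.sum_const, nsmul_eq_mul]
  have h3 : (A.card : ℝ) * (ε / (k + 1)) ≤ k * (ε / (k + 1)) := by
    gcongr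
  have h4 : (k : ℝ) * (ε / (k + 1)) + ε / (k + 1) = ε := by
    field_simp
  linarith

/-- Corollary: the singleton-relay case with `δ = ε/2` (the plain union bound
`P(o ↮ b) ≤ P(o ↮ a) + P(a ↮ b)`). [folklore] -/
theorem nearOneGluing_singleton :
    ∀ ε : ℝ, 0 < ε → ∀ (n : ℕ) (w : Sym2 (Fin n) → unitInterval) (a o b : Fin n),
      1 - ε / 2 < (prodBernoulli w).real (openConn o a) →
      1 - ε / 2 < (prodBernoulli w).real (openConn a b) →
      1 - ε < (prodBernoulli w).real (openConn o b) := by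
  intro ε hε n w a o b h1 h2
  have hsub : (openConn o b : Set (BondConfig (Fin n)))ᶜ ⊆ (openConn o a)ᶜ ∪ (openConn a b)ᶜ := by
    intro ω hω
    by_cases hoa : ω ∈ (openConn o a : Set (BondConfig (Fin n)))
    · exact Or.inr fun hab => hω (openConn_trans hoa hab)
    · exact Or.inl hoa
  have key : (prodBernoulli w).real (openConn o b)ᶜ ≤
      (prodBernoulli w).real (openConn o a)ᶜ + (prodBernoulli w).real (openConn a b)ᶜ :=
    (measureReal_mono hsub).trans (measureReal_union_le _ _)
  simp only [probReal_compl_eq_one_sub MeasurableSet.of_discrete] at key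
  linarith


/-! ## §4 Harris reduction: a counterexample needs `E|C(o) ∩ A| → ∞` ("pocket with few fingers")

The only correlation input available on general graphs, Harris' inequality, already proves the
crux along every family with `δ · Σ_{a∈A} P(o ↔ a)` bounded.  So a counterexample family must have
`E N = Σ_a P(o ↔ a) ≥ ε/δ → ∞` while `P(o ↮ b) ≥ ε`: conditionally on the bad event `o`'s cluster
meets `A` but in `O(δ E N / ε)` points — a heavy LOWER tail of `N = |C(o) ∩ A|` (this is the engine
item `NoHeavyLowerTail`, stmt-4575, made quantitative). -/

/-- **Harris/union reduction.** `P(o ↮ b) ≤ P(o ↮ A) + Σ_{a ∈ A} P(o ↔ a) · P(a ↮ b)`: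
`{o ↮ b} ⊆ {o ↮ A} ∪ ⋃_a ({o ↔ a} ∩ {a ↮ b})`, subadditivity, and Harris for the increasing event
`{o ↔ a}` against the decreasing event `{a ↮ b}`
(`Literature.Probability.LatticeModels.prodBernoulli_harris_upper_lower`). [folklore] -/
theorem real_compl_openConn_le_harris {n : ℕ} (w : Sym2 (Fin n) → unitInterval)
    (A : Finset (Fin n)) (o b : Fin n) :
    (prodBernoulli w).real (openConn o b)ᶜ ≤ (prodBernoulli w).real (⋃ a ∈ A, openConn o a)ᶜ
      + ∑ a ∈ A, (prodBernoulli w).real (openConn o a) * (prodBernoulli w).real (openConn a b)ᶜ := by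
  set μ := prodBernoulli w with hμ
  have hsub : (openConn o b : Set (BondConfig (Fin n)))ᶜ ⊆
      (⋃ a ∈ A, openConn o a)ᶜ ∪ ⋃ a ∈ A, (openConn o a ∩ (openConn a b)ᶜ) := by
    intro ω hω
    by_cases h1 : ω ∈ ⋃ a ∈ A, (openConn o a : Set (BondConfig (Fin n)))
    · right
      obtain ⟨a, ha, hoa⟩ := Set.mem_iUnion₂.1 h1
      exact Set.mem_iUnion₂.2 ⟨a, ha, hoa, fun hab' => hω (openConn_trans hoa hab')⟩
    · left
      exact h1
  calc μ.real (openConn o b)ᶜ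
      ≤ μ.real ((⋃ a ∈ A, openConn o a)ᶜ ∪ ⋃ a ∈ A, (openConn o a ∩ (openConn a b)ᶜ)) :=
        measureReal_mono hsub
    _ ≤ μ.real (⋃ a ∈ A, openConn o a)ᶜ + μ.real (⋃ a ∈ A, (openConn o a ∩ (openConn a b)ᶜ)) :=
        measureReal_union_le _ _
    _ ≤ μ.real (⋃ a ∈ A, openConn o a)ᶜ + ∑ a ∈ A, μ.real (openConn o a ∩ (openConn a b)ᶜ) := by
        gcongr
        exact measureReal_biUnion_finset_le _ _
    _ ≤ μ.real (⋃ a ∈ A, openConn o a)ᶜ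
          + ∑ a ∈ A, μ.real (openConn o a) * μ.real (openConn a b)ᶜ := by
        gcongr with a ha
        exact prodBernoulli_harris_upper_lower w (isUpperSet_openConn o a)
          (isUpperSet_openConn a b).compl MeasurableSet.of_discrete MeasurableSet.of_discrete

/-- **The crux holds along every family with bounded mean intersection**: if
`Σ_{a ∈ A} P(o ↔ a) ≤ K` then `δ = ε/(K+1)` works.  (Generalises `nearOneGluing_of_card_le`;
kn-near-one-gluing card, Engine step 1 with `ρ = 1`.)  Contrapositive for the adversary: a
counterexample family at level `ε` must have `Σ_a P(o ↔ a) > ε/δ - 1`. [folklore] -/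
theorem nearOneGluing_of_mean_le (K : ℝ) (hK : 0 ≤ K) :
    ∀ ε : ℝ, 0 < ε → ∃ δ : ℝ, 0 < δ ∧ ∀ (n : ℕ) (w : Sym2 (Fin n) → unitInterval)
      (A : Finset (Fin n)) (o b : Fin n),
      ∑ a ∈ A, (prodBernoulli w).real (openConn o a) ≤ K →
      1 - δ < (prodBernoulli w).real (⋃ a ∈ A, openConn o a) →
      (∀ a ∈ A, 1 - δ < (prodBernoulli w).real (openConn a b)) →
      1 - ε < (prodBernoulli w).real (openConn o b) := by
  intro ε hε
  refine ⟨ε / (K + 1), by positivity, ?_⟩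
  intro n w A o b hK' hA hab
  set μ := prodBernoulli w with hμ
  have h1 := real_compl_openConn_le_harris w A o b
  simp only [probReal_compl_eq_one_sub MeasurableSet.of_discrete] at h1
  have h2 : ∑ a ∈ A, μ.real (openConn o a) * (1 - μ.real (openConn a b))
      ≤ ∑ a ∈ A, μ.real (openConn o a) * (ε / (K + 1)) :=
    Finset.sum_le_sum fun a ha =>
      mul_le_mul_of_nonneg_left (by linarith [hab a ha]) measureReal_nonneg
  rw [← Finset.sum_mul] at h2
  have h3 : (∑ a ∈ A, μ.real (openConn o a)) * (ε / (K + 1)) ≤ K * (ε / (K + 1)) :=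
    mul_le_mul_of_nonneg_right hK' (by positivity)
  have h4 : K * (ε / (K + 1)) + ε / (K + 1) = ε := by
    field_simp
  linarith

/-! ## §5 Exact probabilities on the 3-vertex path; sharpness of the union-bound rate;
the "lossless" strengthening (δ = ε) is false -/

section Path

/-- If `u` has no neighbour it reaches only itself. [folklore] -/
theorem not_reachable_of_isolated {V : Type*} {G : SimpleGraph V} {u v : V}
    (h : ∀ x, ¬ G.Adj u x) (huv : u ≠ v) : ¬ G.Reachable u v := by
  intro hr
  rw [SimpleGraph.reachable_iff_reflTransGen] at hr
  rcases hr.cases_head with h1 | ⟨c, hc, _⟩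
  · exact huv h1
  · exact h c hc

/-- Weights of the path `0 – 1 – 2` on `Fin 3`: both path edges get `p`, every other pair `0`. -/
def pathW (p : unitInterval) : Sym2 (Fin 3) → unitInterval := fun e =>
  if e = s(0, 1) ∨ e = s(1, 2) then p else 0

variable (p : unitInterval)

/-- weight of the edge `{0,1}` -/
@[simp] theorem pathW_01 : pathW p s(0, 1) = p := by simp [pathW]
/-- weight of the edge `{1,2}` -/
@[simp] theorem pathW_12 : pathW p s(1, 2) = p := by simp [pathW]
/-- weight of the non-edge `{0,2}` -/
@[simp] theorem pathW_02 : pathW p s(0, 2) = 0 := by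
  have h1 : (s(0, 2) : Sym2 (Fin 3)) ≠ s(0, 1) := by decide
  have h2 : (s(0, 2) : Sym2 (Fin 3)) ≠ s(1, 2) := by decide
  simp [pathW, h1, h2]

/-- the two path edges, as a finset -/
def pathEdges : Finset (Sym2 (Fin 3)) := {s(0, 1), s(1, 2)}

/-- `P(both path edges open) = p²` (cylinder probability). [folklore] -/
theorem real_bothOpen : (prodBernoulli (pathW p)).real
    {ω | s(0, 1) ∈ ω ∧ s(1, 2) ∈ ω} = (p : ℝ) ^ 2 := by
  have hset : {ω : Set (Sym2 (Fin 3)) | s(0, 1) ∈ ω ∧ s(1, 2) ∈ ω}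
      = {ω | ((pathEdges : Finset (Sym2 (Fin 3))) : Set (Sym2 (Fin 3))) ⊆ ω} := by
    ext ω
    simp [pathEdges, Set.insert_subset_iff]
  rw [hset, prodBernoulli_real_subset, pathEdges, Finset.prod_pair (by decide)]
  simp [sq]

/-- `P(s(0,2) open) = 0`. [folklore] -/
theorem real_02open : (prodBernoulli (pathW p)).real {ω | s(0, 2) ∈ ω} = 0 := by
  rw [prodBernoulli_real_setOf_mem, pathW_02]
  rfl

/-- `{0 ↔ 2} ⊆ {both path edges open} ∪ {s(0,2) open}` (else `0` or `2` is isolated). -/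
theorem openConn02_subset (ω : BondConfig (Fin 3)) (hω : ω ∈ (openConn (0 : Fin 3) 2)) :
    ω ∈ ({ω : BondConfig (Fin 3) | s(0, 1) ∈ ω ∧ s(1, 2) ∈ ω} ∪ {ω | s(0, 2) ∈ ω}) := by
  by_contra hc
  simp only [Set.mem_union, Set.mem_setOf_eq, not_or, not_and_or] at hc
  obtain ⟨h1 | h2, h02⟩ := hc
  · refine not_reachable_of_isolated (G := openGraph ω) (u := (0 : Fin 3)) (v := 2) ?_ (by decide) hω
    intro x hx
    rw [openGraph_adj] at hx
    fin_cases x <;> simp_all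
  · refine not_reachable_of_isolated (G := openGraph ω) (u := (2 : Fin 3)) (v := 0) ?_ (by decide)
      (SimpleGraph.Reachable.symm hω)
    intro x hx
    rw [openGraph_adj] at hx
    fin_cases x <;> simp_all [Sym2.eq_swap]

/-- `{0 ↔ 1} ⊆ {s(0,1) open} ∪ {s(0,2) open}` (else `0` is isolated). [folklore] -/
theorem openConn01_subset (ω : BondConfig (Fin 3)) (hω : ω ∈ (openConn (0 : Fin 3) 1)) :
    ω ∈ ({ω : BondConfig (Fin 3) | s(0, 1) ∈ ω} ∪ {ω | s(0, 2) ∈ ω}) := by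
  by_contra hc
  simp only [Set.mem_union, Set.mem_setOf_eq, not_or] at hc
  obtain ⟨h1, h02⟩ := hc
  refine not_reachable_of_isolated (G := openGraph ω) (u := (0 : Fin 3)) (v := 1) ?_ (by decide) hω
  intro x hx
  rw [openGraph_adj] at hx
  fin_cases x <;> simp_all

/-- `{1 ↔ 2} ⊆ {s(1,2) open} ∪ {s(0,2) open}` (else `2` is isolated). [folklore] -/
theorem openConn12_subset (ω : BondConfig (Fin 3)) (hω : ω ∈ (openConn (1 : Fin 3) 2)) :
    ω ∈ ({ω : BondConfig (Fin 3) | s(1, 2) ∈ ω} ∪ {ω | s(0, 2) ∈ ω}) := by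
  by_contra hc
  simp only [Set.mem_union, Set.mem_setOf_eq, not_or] at hc
  obtain ⟨h1, h02⟩ := hc
  refine not_reachable_of_isolated (G := openGraph ω) (u := (2 : Fin 3)) (v := 1) ?_ (by decide)
    (SimpleGraph.Reachable.symm hω)
  intro x hx
  rw [openGraph_adj] at hx
  fin_cases x <;> simp_all [Sym2.eq_swap]

/-- **Exact value** `P(0 ↔ 2) = p²` on the path. [folklore] -/
theorem real_openConn02_path : (prodBernoulli (pathW p)).real (openConn (0 : Fin 3) 2) = (p : ℝ) ^ 2 := by
  apply le_antisymm
  · calc (prodBernoulli (pathW p)).real (openConn (0 : Fin 3) 2)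
        ≤ (prodBernoulli (pathW p)).real
            ({ω : BondConfig (Fin 3) | s(0, 1) ∈ ω ∧ s(1, 2) ∈ ω} ∪ {ω | s(0, 2) ∈ ω}) :=
          measureReal_mono (fun ω hω => openConn02_subset ω hω)
      _ ≤ (prodBernoulli (pathW p)).real {ω : BondConfig (Fin 3) | s(0, 1) ∈ ω ∧ s(1, 2) ∈ ω}
            + (prodBernoulli (pathW p)).real {ω : BondConfig (Fin 3) | s(0, 2) ∈ ω} :=
          measureReal_union_le _ _
      _ = (p : ℝ) ^ 2 := by rw [real_bothOpen, real_02open, add_zero]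
  · rw [← real_bothOpen p]
    refine measureReal_mono ?_
    rintro ω ⟨h01, h12⟩
    have a01 : (openGraph ω).Adj 0 1 := (openGraph_adj ω 0 1).2 ⟨h01, by decide⟩
    have a12 : (openGraph ω).Adj 1 2 := (openGraph_adj ω 1 2).2 ⟨h12, by decide⟩
    exact a01.reachable.trans a12.reachable

/-- **Exact value** `P(0 ↔ 1) = p` on the path. [folklore] -/
theorem real_openConn01_path : (prodBernoulli (pathW p)).real (openConn (0 : Fin 3) 1) = (p : ℝ) := by
  apply le_antisymm
  · calc (prodBernoulli (pathW p)).real (openConn (0 : Fin 3) 1)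
        ≤ (prodBernoulli (pathW p)).real
            ({ω : BondConfig (Fin 3) | s(0, 1) ∈ ω} ∪ {ω | s(0, 2) ∈ ω}) :=
          measureReal_mono (fun ω hω => openConn01_subset ω hω)
      _ ≤ (prodBernoulli (pathW p)).real {ω : BondConfig (Fin 3) | s(0, 1) ∈ ω}
            + (prodBernoulli (pathW p)).real {ω : BondConfig (Fin 3) | s(0, 2) ∈ ω} :=
          measureReal_union_le _ _
      _ = (p : ℝ) := by rw [prodBernoulli_real_setOf_mem, real_02open, add_zero, pathW_01]
  · calc (p : ℝ) = (prodBernoulli (pathW p)).real {ω : BondConfig (Fin 3) | s(0, 1) ∈ ω} := by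
          rw [prodBernoulli_real_setOf_mem, pathW_01]
      _ ≤ _ := by
          refine measureReal_mono ?_
          intro ω h01
          exact ((openGraph_adj ω 0 1).2 ⟨h01, by decide⟩).reachable

/-- **Exact value** `P(1 ↔ 2) = p` on the path. [folklore] -/
theorem real_openConn12_path : (prodBernoulli (pathW p)).real (openConn (1 : Fin 3) 2) = (p : ℝ) := by
  apply le_antisymm
  · calc (prodBernoulli (pathW p)).real (openConn (1 : Fin 3) 2)
        ≤ (prodBernoulli (pathW p)).real
            ({ω : BondConfig (Fin 3) | s(1, 2) ∈ ω} ∪ {ω | s(0, 2) ∈ ω}) :=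
          measureReal_mono (fun ω hω => openConn12_subset ω hω)
      _ ≤ (prodBernoulli (pathW p)).real {ω : BondConfig (Fin 3) | s(1, 2) ∈ ω}
            + (prodBernoulli (pathW p)).real {ω : BondConfig (Fin 3) | s(0, 2) ∈ ω} :=
          measureReal_union_le _ _
      _ = (p : ℝ) := by rw [prodBernoulli_real_setOf_mem, real_02open, add_zero, pathW_12]
  · calc (p : ℝ) = (prodBernoulli (pathW p)).real {ω : BondConfig (Fin 3) | s(1, 2) ∈ ω} := by
          rw [prodBernoulli_real_setOf_mem, pathW_12]
      _ ≤ _ := by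
          refine measureReal_mono ?_
          intro ω h12
          exact ((openGraph_adj ω 1 2).2 ⟨h12, by decide⟩).reachable

end Path

/-- NATURAL STRENGTHENING 1 — "lossless gluing" (`δ = ε`): false. -/
def NearOneGluingLossless : Prop :=
  ∀ ε : ℝ, 0 < ε → ∀ (n : ℕ) (w : Sym2 (Fin n) → unitInterval) (A : Finset (Fin n)) (o b : Fin n),
    1 - ε < (prodBernoulli w).real (⋃ a ∈ A, openConn o a) →
      (∀ a ∈ A, 1 - ε < (prodBernoulli w).real (openConn a b)) →
        1 - ε < (prodBernoulli w).real (openConn o b)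

/-- a weight `7/10` -/
noncomputable def w710 : unitInterval := ⟨7 / 10, by norm_num, by norm_num⟩

/-- Gluing MUST lose: on the path with edge weights `7/10`, `ε = 1/2`, `A = {1}`:
`P(0 ↔ A) = P(1 ↔ 2) = 0.7 > 1/2` but `P(0 ↔ 2) = 0.49 < 1/2`.  So `δ < ε` is forced
(indeed `δ ≤ ε/2 · (1 + o(1))`, next theorem). [folklore] -/
theorem not_nearOneGluingLossless : ¬ NearOneGluingLossless := by
  intro h
  have key := h (1 / 2) (by norm_num) 3 (pathW w710) {1} 0 2
    (by rw [Finset.set_biUnion_singleton, real_openConn01_path]; norm_num [w710])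
    (by
      intro a ha
      rw [Finset.mem_singleton] at ha
      subst ha
      rw [real_openConn12_path]; norm_num [w710])
  rw [real_openConn02_path] at key
  norm_num [w710] at key

/-- NATURAL STRENGTHENING 2 — a better-than-union-bound RATE for a single relay: for `|A| = 1`
the union bound gives `δ = ε/2` (`nearOneGluing_singleton`); NO `δ = c ε` with `c > 1/2` works,
witnessed by the path with `1 - p = t`, `ε = t (2 - t)` (`P(o ↮ b) = 1 - p² = ε` exactly while
`P(o ↮ a) = P(a ↮ b) = t < c ε`).  So the linear rate of §3 is sharp for `k = 1`; whether
`δ = ε/2` works for EVERY `|A|` is exactly `AdditiveGluing` (stmt-4576) / KN Conjecture 1. [folklore] -/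
theorem unionBound_rate_sharp (c : ℝ) (hc : 1 / 2 < c) :
    ¬ (∀ ε : ℝ, 0 < ε → ∀ (n : ℕ) (w : Sym2 (Fin n) → unitInterval) (a o b : Fin n),
        1 - c * ε < (prodBernoulli w).real (openConn o a) →
        1 - c * ε < (prodBernoulli w).real (openConn a b) →
        1 - ε < (prodBernoulli w).real (openConn o b)) := by
  intro h
  -- t = min (1/2) ((2 - 1/c)/2) ∈ (0, 1/2], p = 1 - t, ε = t (2 - t)
  have hc0 : 0 < c := by linarith
  set t : ℝ := min (1 / 2) ((2 - 1 / c) / 2) with ht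
  have ht0 : 0 < t := by
    rw [ht, lt_min_iff]
    refine ⟨by norm_num, ?_⟩
    have : 1 / c < 2 := by rw [div_lt_iff₀ hc0]; linarith
    linarith
  have ht1 : t ≤ 1 / 2 := min_le_left _ _
  have ht2 : t ≤ (2 - 1 / c) / 2 := min_le_right _ _
  have hp : (1 - t) ∈ unitInterval := ⟨by linarith, by linarith⟩
  set p : unitInterval := ⟨1 - t, hp⟩ with hpdef
  have hpval : (p : ℝ) = 1 - t := rfl
  have hε : 0 < t * (2 - t) := mul_pos ht0 (by linarith)
  -- hypotheses: t < c ε, i.e. t < c t (2 - t) ⟸ 1 < c (2 - t) ⟸ t ≤ (2 - 1/c)/2 < 2 - 1/c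
  have hct : 1 - c * (t * (2 - t)) < 1 - t := by
    have h1 : 1 < c * (2 - t) := by
      have : c * (2 - t) ≥ c * (2 - (2 - 1 / c) / 2) := by nlinarith
      have h2 : c * (2 - (2 - 1 / c) / 2) = c + 1 / 2 := by field_simp; ring
      linarith
    nlinarith
  have key := h (t * (2 - t)) hε 3 (pathW p) 1 0 2
    (by rw [real_openConn01_path, hpval]; exact hct)
    (by rw [real_openConn12_path, hpval]; exact hct)
  rw [real_openConn02_path, hpval] at key
  nlinarith


/-! ## §7 Vertex deletion under Harris; the first layer is not load-bearing

(C8) For `a ∉ X ∌ b`: `P(a ↮ b avoiding X) · P(X ↮ b) ≤ P(a ↮ b)` — two decreasing events whose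
intersection forces `a ↮ b`.  With `X = {o}` and a would-be counterexample (`P(o ↮ b) ≥ ε`):
EVERY relay stays `(δ/ε)`-reliable after deleting `o` — relays cannot owe their reliability to
`o`.  Consequence (`nearOneGluing_depth_one`): if every positive-weight neighbour of `o` is a
relay ("`o` isolated in `G ∖ A`", the hypothesis of Kozma–Nitzan's Theorems 5/8 for the exact
conjectures), the crux holds with `δ = ε²/4`.  So a counterexample needs a non-relay buffer
between `o` and `A` (depth ≥ 2), cf. §6. -/

section DepthOne

variable {n : ℕ}

/-- The pairs containing `o`. -/
def edgesAt (o : Fin n) : Finset (Sym2 (Fin n)) := Finset.univ.filter fun e => o ∈ e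

/-- The cylinder event "the set of `v ≠ o` with `s(o, v)` open is exactly `L`". -/
def starEq (o : Fin n) (L : Finset (Fin n)) : Set (BondConfig (Fin n)) :=
  {ω | ∀ v, v ≠ o → (s(o, v) ∈ ω ↔ v ∈ L)}

/-- `{a ↔ b avoiding o}`. -/
abbrev offConn (o a b : Fin n) : Set (BondConfig (Fin n)) :=
  openConnIn (({o} : Set (Fin n))ᶜ) a b

/-- The complement of an event determined by `F` is determined by `F`. [folklore] -/
theorem determinedBy_compl' {ι : Type*} {E : Set (Set ι)} {F : Set ι} (h : DeterminedBy E F) :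
    DeterminedBy Eᶜ F := by
  rw [determinedBy_iff] at h ⊢
  intro ω ω' hF
  exact not_congr (h ω ω' hF)

/-- The star cylinder is determined by the pairs containing `o`. [folklore] -/
theorem determinedBy_starEq (o : Fin n) (L : Finset (Fin n)) :
    DeterminedBy (starEq o L) (↑(edgesAt o) : Set (Sym2 (Fin n))) := by
  rw [determinedBy_iff]
  intro ω ω' hF
  simp only [starEq, Set.mem_setOf_eq]
  refine forall₂_congr fun v _ => ?_
  have he : s(o, v) ∈ (↑(edgesAt o) : Set (Sym2 (Fin n))) := by simp [edgesAt]
  have hiff : s(o, v) ∈ ω ↔ s(o, v) ∈ ω' :=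
    ⟨fun h1 => ((Set.ext_iff.1 hF _).1 ⟨h1, he⟩).1, fun h1 => ((Set.ext_iff.1 hF _).2 ⟨h1, he⟩).1⟩
  rw [hiff]

/-- `{a ↔ b avoiding o}` is determined by the pairs NOT containing `o`. [folklore] -/
theorem determinedBy_offConn (o a b : Fin n) :
    DeterminedBy (offConn o a b) (↑(edgesAt o) : Set (Sym2 (Fin n)))ᶜ := by
  rw [determinedBy_iff]
  intro ω ω' h
  have key : (openGraph ω).induce (({o} : Set (Fin n))ᶜ) =
      (openGraph ω').induce (({o} : Set (Fin n))ᶜ) := by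
    ext u v
    simp only [SimpleGraph.comap_adj, Function.Embedding.coe_subtype, openGraph_adj]
    have hu : (u : Fin n) ≠ o := fun h' => u.2 (by simp [h'])
    have hv : (v : Fin n) ≠ o := fun h' => v.2 (by simp [h'])
    have hmem : s((u : Fin n), (v : Fin n)) ∈ (↑(edgesAt o) : Set (Sym2 (Fin n)))ᶜ := by
      simp only [Set.mem_compl_iff, Finset.mem_coe, edgesAt, Finset.mem_filter, Finset.mem_univ,
        true_and, Sym2.mem_iff, not_or]
      exact ⟨fun h' => hu h'.symm, fun h' => hv h'.symm⟩
    have hiff : s((u : Fin n), (v : Fin n)) ∈ ω ↔ s((u : Fin n), (v : Fin n)) ∈ ω' :=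
      ⟨fun h1 => ((Set.ext_iff.1 h _).1 ⟨h1, hmem⟩).1,
        fun h1 => ((Set.ext_iff.1 h _).2 ⟨h1, hmem⟩).1⟩
    rw [hiff]
  simp only [offConn, openConnIn, Set.mem_setOf_eq, key]

/-- **(C8) Harris vertex deletion.** `P(a ↮ b avoiding o) · P(o ↮ b) ≤ P(a ↮ b)`. [folklore] -/
theorem real_offConn_compl_mul_le (w : Sym2 (Fin n) → unitInterval) (o a b : Fin n) :
    (prodBernoulli w).real (offConn o a b)ᶜ * (prodBernoulli w).real (openConn o b)ᶜ ≤
      (prodBernoulli w).real (openConn a b)ᶜ := by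
  classical
  have hsub : (offConn o a b)ᶜ ∩ (openConn o b)ᶜ ⊆ (openConn a b : Set (BondConfig (Fin n)))ᶜ := by
    rintro ω ⟨h1, h2⟩ hab
    obtain ⟨p⟩ := (hab : (openGraph ω).Reachable a b)
    by_cases ho : o ∈ p.support
    · exact h2 ⟨p.dropUntil o ho⟩
    · apply h1
      have hS : ∀ z ∈ p.support, z ∈ (({o} : Set (Fin n))ᶜ) := by
        intro z hz hzo
        rw [Set.mem_singleton_iff] at hzo
        exact ho (hzo ▸ hz)
      exact ⟨hS a p.start_mem_support, hS b p.end_mem_support, ⟨p.induce _ hS⟩⟩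
  calc (prodBernoulli w).real (offConn o a b)ᶜ * (prodBernoulli w).real (openConn o b)ᶜ
      ≤ (prodBernoulli w).real ((offConn o a b)ᶜ ∩ (openConn o b)ᶜ) :=
        prodBernoulli_harris_lower w (isUpperSet_openConnIn _ _ _).compl
          (isUpperSet_openConn o b).compl MeasurableSet.of_discrete MeasurableSet.of_discrete
    _ ≤ (prodBernoulli w).real (openConn a b)ᶜ := measureReal_mono hsub

/-- **(C8, set form) Harris deletion of a vertex SET.** For a finite set `X` of vertices:
`P(a ↮ b avoiding X) · P(X ↮ b) ≤ P(a ↮ b)` — an open path from `a` to `b` either avoids `X`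
or passes through some `x ∈ X`, which is then joined to `b`.  Used with `X = W` a relay-free
pocket of `o` in §6 (C7): linked relays are `δ/ρ(W)`-reliable in `G − W`. [folklore] -/
theorem real_openConnIn_compl_mul_le (w : Sym2 (Fin n) → unitInterval) (X : Finset (Fin n))
    (a b : Fin n) :
    (prodBernoulli w).real (openConnIn ((↑X : Set (Fin n))ᶜ) a b)ᶜ *
        (prodBernoulli w).real (⋃ x ∈ X, openConn x b)ᶜ ≤
      (prodBernoulli w).real (openConn a b)ᶜ := by
  classical
  have hsub : (openConnIn ((↑X : Set (Fin n))ᶜ) a b)ᶜ ∩ (⋃ x ∈ X, openConn x b)ᶜ ⊆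
      (openConn a b : Set (BondConfig (Fin n)))ᶜ := by
    rintro ω ⟨h1, h2⟩ hab
    obtain ⟨p⟩ := (hab : (openGraph ω).Reachable a b)
    by_cases hX : ∃ x ∈ X, x ∈ p.support
    · obtain ⟨x, hxX, hxp⟩ := hX
      exact h2 (Set.mem_iUnion₂.2 ⟨x, hxX, ⟨p.dropUntil x hxp⟩⟩)
    · apply h1
      have hS : ∀ z ∈ p.support, z ∈ ((↑X : Set (Fin n))ᶜ) :=
        fun z hz hzX => hX ⟨z, Finset.mem_coe.1 hzX, hz⟩
      exact ⟨hS a p.start_mem_support, hS b p.end_mem_support, ⟨p.induce _ hS⟩⟩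
  have hU : IsUpperSet (⋃ x ∈ X, (openConn x b : Set (BondConfig (Fin n)))) :=
    isUpperSet_iUnion₂ fun x _ => isUpperSet_openConn x b
  calc (prodBernoulli w).real (openConnIn ((↑X : Set (Fin n))ᶜ) a b)ᶜ *
        (prodBernoulli w).real (⋃ x ∈ X, openConn x b)ᶜ
      ≤ (prodBernoulli w).real
          ((openConnIn ((↑X : Set (Fin n))ᶜ) a b)ᶜ ∩ (⋃ x ∈ X, openConn x b)ᶜ) :=
        prodBernoulli_harris_lower w (isUpperSet_openConnIn _ _ _).compl hU.compl
          MeasurableSet.of_discrete MeasurableSet.of_discrete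
    _ ≤ (prodBernoulli w).real (openConn a b)ᶜ := measureReal_mono hsub

/-- The star cylinders are pairwise disjoint (over `L ⊆ univ ∖ {o}`). -/
theorem starEq_disjoint (o : Fin n) {L L' : Finset (Fin n)} (hL : o ∉ L) (hL' : o ∉ L')
    (hne : L ≠ L') : Disjoint (starEq o L) (starEq o L') := by
  rw [Set.disjoint_left]
  intro ω h h'
  apply hne
  ext v
  by_cases hv : v = o
  · subst hv
    exact ⟨fun h1 => (hL h1).elim, fun h1 => (hL' h1).elim⟩
  · exact (h v hv).symm.trans (h' v hv)

/-- **The first layer is not load-bearing** (`o` isolated in `G ∖ A`): if every `v ≠ o` outside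
`A` has `w s(o, v) = 0`, then the crux holds with `δ = ε² / 4`.  Proof: condition on the star of
`o` (cylinders `starEq o L`, independent of the avoid-`o` events); on `starEq o L` with `L ≠ ∅`,
`o ↮ b` forces `a ↮ b avoiding o` for `a ∈ L`, an event of probability `≤ δ / P(o ↮ b)` by
`real_offConn_compl_mul_le`; hence `P(o ↮ b)² ≤ δ P(o ↮ b) + δ ≤ 2δ`.  (Kozma–Nitzan prove the
exact Conjectures 4 ⊇ 2 ⊇ 1 in this situation, arXiv:2401.12397 Thm 8; this ε–δ form with an
explicit rate is all the adversary needs: counterexamples have depth ≥ 2.) [folklore] -/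
theorem nearOneGluing_depth_one :
    ∀ ε : ℝ, 0 < ε → ∃ δ : ℝ, 0 < δ ∧ ∀ (n : ℕ) (w : Sym2 (Fin n) → unitInterval)
      (A : Finset (Fin n)) (o b : Fin n),
      (∀ v, v ≠ o → v ∉ A → w s(o, v) = 0) →
      1 - δ < (prodBernoulli w).real (⋃ a ∈ A, openConn o a) →
      (∀ a ∈ A, 1 - δ < (prodBernoulli w).real (openConn a b)) →
      1 - ε < (prodBernoulli w).real (openConn o b) := by
  intro ε hε
  refine ⟨ε ^ 2 / 4, by positivity, ?_⟩
  intro n w A o b hN hA hab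
  classical
  set μ := prodBernoulli w with hμ
  -- if `o ∈ A`, `o` itself is reliable
  by_cases hoA : o ∈ A
  · have h1 := hab o hoA
    have h0 : 0 ≤ μ.real (openConn o b) := measureReal_nonneg
    rcases le_or_gt ε 4 with h4 | h4
    · nlinarith
    · linarith
  set β := μ.real (openConn o b)ᶜ with hβ
  have hβ1 : β ≤ 1 := measureReal_le_one
  have hβ0 : 0 ≤ β := measureReal_nonneg
  set δ := ε ^ 2 / 4 with hδ
  -- index set of nonempty stars
  set P := ((Finset.univ.erase o).powerset).filter (fun L => L.Nonempty) with hP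
  -- the decomposition of `{o ↮ b}`
  have hcover : (openConn o b : Set (BondConfig (Fin n)))ᶜ ⊆
      starEq o ∅ ∪ ⋃ L ∈ P, (starEq o L ∩ ⋂ a ∈ L, (offConn o a b)ᶜ) := by
    intro ω hω
    set L₀ := (Finset.univ.erase o).filter (fun v => s(o, v) ∈ ω) with hL₀
    have hmem : ω ∈ starEq o L₀ := by
      intro v hv
      simp [hL₀, hv]
    by_cases hne : L₀.Nonempty
    · right
      refine Set.mem_iUnion₂.2 ⟨L₀, ?_, hmem, ?_⟩
      · simp only [hP, Finset.mem_filter, Finset.mem_powerset]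
        exact ⟨Finset.filter_subset _ _, hne⟩
      · refine Set.mem_iInter₂.2 fun a ha => ?_
        intro hconn
        have ha' : a ≠ o ∧ s(o, a) ∈ ω := by simpa [hL₀] using ha
        apply hω
        obtain ⟨_, _, hr⟩ := hconn
        have hab' : (openGraph ω).Reachable a b :=
          hr.map (SimpleGraph.Embedding.induce _).toHom
        have hoa : (openGraph ω).Adj o a := (openGraph_adj ω o a).2 ⟨ha'.2, ha'.1.symm⟩
        exact hoa.reachable.trans hab'
    · left
      rw [Finset.not_nonempty_iff_eq_empty] at hne
      rwa [hne] at hmem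
  -- measure of the empty star: `o` isolated, so `o ↮ A`
  have hempty : μ.real (starEq o ∅) ≤ δ := by
    have hsub : starEq o ∅ ⊆ (⋃ a ∈ A, (openConn o a : Set (BondConfig (Fin n))))ᶜ := by
      intro ω hω hU
      obtain ⟨a, ha, hoa⟩ := Set.mem_iUnion₂.1 hU
      have hao : a ≠ o := fun h => hoA (h ▸ ha)
      refine not_reachable_of_isolated (G := openGraph ω) (u := o) (v := a) ?_ (Ne.symm hao) hoa
      intro x hx
      rw [openGraph_adj] at hx
      exact ((hω x (Ne.symm hx.2)).1 hx.1 : x ∈ (∅ : Finset (Fin n))) |> Finset.notMem_empty x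
    have h1 := measureReal_mono (μ := μ) hsub
    rw [probReal_compl_eq_one_sub MeasurableSet.of_discrete] at h1
    linarith
  -- each nonempty star term
  have hterm : ∀ L ∈ P, μ.real (starEq o L ∩ ⋂ a ∈ L, (offConn o a b)ᶜ) * β ≤
      μ.real (starEq o L) * δ := by
    intro L hL
    simp only [hP, Finset.mem_filter, Finset.mem_powerset] at hL
    obtain ⟨hLsub, ⟨a₀, ha₀⟩⟩ := hL
    have ha₀o : a₀ ≠ o := Finset.ne_of_mem_erase (hLsub ha₀)
    have hind : μ.real (starEq o L ∩ (offConn o a₀ b)ᶜ) =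
        μ.real (starEq o L) * μ.real (offConn o a₀ b)ᶜ :=
      prodBernoulli_real_inter_of_determinedBy w (edgesAt o) (determinedBy_starEq o L)
        (determinedBy_compl' (determinedBy_offConn o a₀ b)) MeasurableSet.of_discrete
        MeasurableSet.of_discrete
    have hmono : μ.real (starEq o L ∩ ⋂ a ∈ L, (offConn o a b)ᶜ) ≤
        μ.real (starEq o L ∩ (offConn o a₀ b)ᶜ) :=
      measureReal_mono (Set.inter_subset_inter_right _ (Set.biInter_subset_of_mem ha₀))
    by_cases ha₀A : a₀ ∈ A
    · have hC8 := real_offConn_compl_mul_le w o a₀ b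
      have hrel : μ.real (openConn a₀ b)ᶜ ≤ δ := by
        have := hab a₀ ha₀A
        rw [probReal_compl_eq_one_sub MeasurableSet.of_discrete]
        linarith
      calc μ.real (starEq o L ∩ ⋂ a ∈ L, (offConn o a b)ᶜ) * β
          ≤ μ.real (starEq o L ∩ (offConn o a₀ b)ᶜ) * β :=
            mul_le_mul_of_nonneg_right hmono hβ0
        _ = μ.real (starEq o L) * (μ.real (offConn o a₀ b)ᶜ * β) := by rw [hind, mul_assoc]
        _ ≤ μ.real (starEq o L) * δ :=
            mul_le_mul_of_nonneg_left (hC8.trans hrel) measureReal_nonneg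
    · -- a₀ ∉ A: the edge `s(o, a₀)` has weight 0, so the star `L ∋ a₀` is a null event
      have h0 : w s(o, a₀) = 0 := hN a₀ ha₀o ha₀A
      have hnull : μ.real (starEq o L) = 0 := by
        apply le_antisymm _ measureReal_nonneg
        calc μ.real (starEq o L) ≤ μ.real {ω : Set (Sym2 (Fin n)) | s(o, a₀) ∈ ω} :=
              measureReal_mono fun ω hω => (hω a₀ ha₀o).2 ha₀
          _ = 0 := by rw [hμ, prodBernoulli_real_setOf_mem, h0]; rfl
      have hle : μ.real (starEq o L ∩ ⋂ a ∈ L, (offConn o a b)ᶜ) ≤ 0 := by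
        calc _ ≤ μ.real (starEq o L) := measureReal_mono Set.inter_subset_left
          _ = 0 := hnull
      have := measureReal_nonneg (μ := μ) (s := starEq o L ∩ ⋂ a ∈ L, (offConn o a b)ᶜ)
      rw [hnull, zero_mul]
      nlinarith
  -- sum of star probabilities is at most one
  have hsum : ∑ L ∈ P, μ.real (starEq o L) ≤ 1 := by
    have hdisj : Set.PairwiseDisjoint (↑P : Set (Finset (Fin n))) (starEq o) := by
      intro L hL L' hL' hne
      simp only [hP, Finset.coe_filter, Finset.mem_powerset, Set.mem_setOf_eq] at hL hL'
      exact starEq_disjoint o (fun h => Finset.notMem_erase o _ (hL.1 h))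
        (fun h => Finset.notMem_erase o _ (hL'.1 h)) hne
    rw [← measureReal_biUnion_finset hdisj fun _ _ => MeasurableSet.of_discrete]
    exact measureReal_le_one
  -- assemble: β ≤ δ + Σ terms, β² ≤ δ β + δ Σ P(starEq) ≤ 2 δ
  have hβle : β ≤ μ.real (starEq o ∅) +
      ∑ L ∈ P, μ.real (starEq o L ∩ ⋂ a ∈ L, (offConn o a b)ᶜ) :=
    (measureReal_mono hcover).trans
      ((measureReal_union_le _ _).trans (by gcongr; exact measureReal_biUnion_finset_le _ _))
  have hsq : β * β ≤ δ * β + δ := by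
    have h1 : (∑ L ∈ P, μ.real (starEq o L ∩ ⋂ a ∈ L, (offConn o a b)ᶜ)) * β ≤
        (∑ L ∈ P, μ.real (starEq o L)) * δ := by
      rw [Finset.sum_mul, Finset.sum_mul]
      exact Finset.sum_le_sum hterm
    have h2 : (∑ L ∈ P, μ.real (starEq o L)) * δ ≤ δ :=
      (mul_le_mul_of_nonneg_right hsum (by positivity)).trans (by rw [one_mul])
    nlinarith [mul_le_mul_of_nonneg_right hβle hβ0, hempty]
  -- conclude: β² ≤ 2δ = ε²/2 < ε², so β < ε
  have hβε : β < ε := by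
    by_contra hge
    rw [not_lt] at hge
    nlinarith
  rw [hβ, probReal_compl_eq_one_sub MeasurableSet.of_discrete] at hβε
  linarith

end DepthOne

/-! ## §8 Normal form: the relay set may be taken SATURATED (`A = A*_δ :=` all `δ`-reliable vertices)

Enlarging `A` weakens neither hypothesis, so the crux is equivalent to its restriction to the
canonical relay set `relSet w b δ = {a | P(a ↔ b) > 1 - δ}`.  For the adversary this means: in a
counterexample every NON-relay is genuinely unreliable (`P(u ↮ b) ≥ δ`), in particular `o`'s
buffer (§6, §7) consists of unreliable vertices only; for provers: one hypothesis instead of two. -/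

section Saturated

/-- The saturated relay set at level `δ`: all vertices `a` with `P(a ↔ b) > 1 - δ`. -/
noncomputable def relSet {n : ℕ} (w : Sym2 (Fin n) → unitInterval) (b : Fin n) (δ : ℝ) :
    Finset (Fin n) :=
  Finset.univ.filter fun a => 1 - δ < (prodBernoulli w).real (openConn a b)

/-- `NearOneGluing` with the canonical (saturated) relay set and a single hypothesis. -/
def NearOneGluingSaturated : Prop :=
  ∀ ε : ℝ, 0 < ε → ∃ δ : ℝ, 0 < δ ∧ ∀ (n : ℕ) (w : Sym2 (Fin n) → unitInterval) (o b : Fin n),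
    1 - δ < (prodBernoulli w).real (⋃ a ∈ relSet w b δ, openConn o a) →
      1 - ε < (prodBernoulli w).real (openConn o b)

/-- **Saturation is without loss of generality**: `NearOneGluing ↔ NearOneGluingSaturated`.
[folklore] -/
theorem nearOneGluing_iff_saturated : NearOneGluing ↔ NearOneGluingSaturated := by
  constructor
  · intro h ε hε
    obtain ⟨δ, hδ, H⟩ := h ε hε
    refine ⟨δ, hδ, fun n w o b hA => H n w (relSet w b δ) o b hA ?_⟩
    intro a ha
    simpa [relSet] using ha
  · intro h ε hε
    obtain ⟨δ, hδ, H⟩ := h ε hε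
    refine ⟨δ, hδ, fun n w A o b hA hrel => H n w o b (lt_of_lt_of_le hA ?_)⟩
    have hsub : (⋃ a ∈ A, (openConn o a : Set (BondConfig (Fin n)))) ⊆
        ⋃ a ∈ relSet w b δ, openConn o a := by
      intro ω hω
      obtain ⟨a, ha, hoa⟩ := Set.mem_iUnion₂.1 hω
      refine Set.mem_iUnion₂.2 ⟨a, ?_, hoa⟩
      simpa [relSet] using hrel a ha
    exact measureReal_mono hsub (measure_ne_top _ _)

/-- In the saturated form the base vertex is never a relay of a counterexample: if
`o ∈ relSet w b δ` with `δ ≤ ε` the conclusion holds outright. [folklore] -/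
theorem conclusion_of_mem_relSet {n : ℕ} (w : Sym2 (Fin n) → unitInterval) (o b : Fin n)
    {δ ε : ℝ} (hδε : δ ≤ ε) (ho : o ∈ relSet w b δ) :
    1 - ε < (prodBernoulli w).real (openConn o b) := by
  have h : 1 - δ < (prodBernoulli w).real (openConn o b) := by simpa [relSet] using ho
  linarith

end Saturated

/-! ## §9 The relay-free pocket decomposition (C6–C7 made formal)

Let `U = V ∖ A` and `C_U(o)` the open cluster of `o` using non-relays only.  The events
`pocketEq A o W = {C_U(o) = W}` partition the space; `pocketEq A o W` is determined by the `U`-edges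
touching `W` (`pocketEdges`), the set of relays linked to `W` by an open edge is determined by the
`W–A` edges (`linkEdges`), and `{a ↔ b avoiding W}` by the edges avoiding `W` — three disjoint
families, hence independent.  On `pocketEq W ∩ {o ↔ A} ∩ {o ↮ b}` some relay is linked and EVERY
linked relay fails avoiding `W`.  This gives `pocket_bad_le` and, with Harris deletion (§7),
`pocket_bad_mul_le : P(C_U(o) = W, bad) · P(W ↮ b) ≤ δ · P(C_U(o) = W)`, whence
`bad_unreliablePocket_le : P(bad, P(C_U(o) ↮ b) ≥ r) ≤ δ / r` — the bad event lives on RELIABLE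
relay-free pockets. -/

section Pocket

variable {n : ℕ}

private theorem openConnIn_mono' {V : Type*} {S S' : Set V} (h : S ⊆ S') (x y : V) :
    (openConnIn S x y : Set (BondConfig V)) ⊆ openConnIn S' x y := by
  rintro ω ⟨hx, hy, hr⟩
  exact ⟨h hx, h hy, hr.map (SimpleGraph.induceHomOfLE (G := openGraph ω) h).toHom⟩

private theorem openConnIn_univ_of_reachable' {V : Type*} {ω : BondConfig V} {x y : V}
    (h : (openGraph ω).Reachable x y) : ω ∈ openConnIn Set.univ x y :=
  ⟨trivial, trivial, h.map (SimpleGraph.induceUnivIso (openGraph ω)).symm.toHom⟩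

private theorem reachable_of_openConnIn' {V : Type*} {ω : BondConfig V} {S : Set V} {x y : V}
    (h : ω ∈ openConnIn S x y) : (openGraph ω).Reachable x y := by
  obtain ⟨_, _, hr⟩ := h
  exact hr.map (SimpleGraph.Embedding.induce _).toHom

/-- First-exit edge of an open path (local copy of `exists_openConnIn_exit`). [folklore] -/
private theorem exists_exit {V : Type*} {ω : BondConfig V} {S T : Set V} {x y : V} (hx : x ∈ T)
    (hy : y ∉ T) (h : ω ∈ openConnIn S x y) :
    ∃ u z, u ∈ T ∧ z ∉ T ∧ z ∈ S ∧ s(u, z) ∈ ω ∧ u ≠ z ∧ ω ∈ openConnIn (S ∩ T) x u := by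
  obtain ⟨hxS, hyS, ⟨p⟩⟩ := h
  suffices H : ∀ (a b : S) (p : ((openGraph ω).induce S).Walk a b), (a : V) ∈ T → (b : V) ∉ T →
      ∃ u z, u ∈ T ∧ z ∉ T ∧ z ∈ S ∧ s(u, z) ∈ ω ∧ u ≠ z ∧ ω ∈ openConnIn (S ∩ T) a u from
    H ⟨x, hxS⟩ ⟨y, hyS⟩ p hx hy
  intro a b p
  induction p with
  | nil => intro ha hb; exact absurd ha hb
  | cons hadj p ih =>
    intro ha hb
    rename_i a c b'
    have hadj' : (openGraph ω).Adj a c := hadj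
    obtain ⟨hmem, hne⟩ := (openGraph_adj _ _ _).1 hadj'
    by_cases hc : (c : V) ∈ T
    · obtain ⟨u, z, hu, hz, hzS, huz, hne', hr⟩ := ih hc hb
      exact ⟨u, z, hu, hz, hzS, huz, hne',
        PlanarDuality.openConnIn_trans (openConnIn_of_adj ⟨a.2, ha⟩ ⟨c.2, hc⟩ hmem hne) hr⟩
    · exact ⟨a, c, ha, hc, c.2, hmem, hne, openConnIn_refl ⟨a.2, ha⟩⟩

/-- `{x ↔ y in S}` depends only on the pairs inside `S`. [folklore] -/
theorem determinedBy_openConnIn' (S : Set (Fin n)) (x y : Fin n) :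
    DeterminedBy (openConnIn S x y : Set (BondConfig (Fin n))) S.sym2 := by
  rw [determinedBy_iff]
  intro ω ω' h
  have key : (openGraph ω).induce S = (openGraph ω').induce S := by
    ext u v
    simp only [SimpleGraph.comap_adj, Function.Embedding.coe_subtype, openGraph_adj]
    have hmem : s(u.1, v.1) ∈ S.sym2 := Set.mk_mem_sym2_iff.2 ⟨u.2, v.2⟩
    have hiff : s(u.1, v.1) ∈ ω ↔ s(u.1, v.1) ∈ ω' :=
      ⟨fun h1 => ((Set.ext_iff.1 h _).1 ⟨h1, hmem⟩).1,
        fun h1 => ((Set.ext_iff.1 h _).2 ⟨h1, hmem⟩).1⟩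
    rw [hiff]
  simp only [openConnIn, Set.mem_setOf_eq, key]

/-- `{o ↔ v}` through non-relays only. -/
abbrev uConn (A : Finset (Fin n)) (o v : Fin n) : Set (BondConfig (Fin n)) :=
  openConnIn ((↑A : Set (Fin n))ᶜ) o v

/-- The event "the relay-free pocket `C_U(o)` is exactly `W`". -/
def pocketEq (A : Finset (Fin n)) (o : Fin n) (W : Finset (Fin n)) : Set (BondConfig (Fin n)) :=
  {ω | ∀ v, ω ∈ uConn A o v ↔ v ∈ W}

/-- The `U`-edges touching `W` (pairs `{u, v}` with `u ∈ W`, `v ∉ A`). -/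
def pocketEdges (A W : Finset (Fin n)) : Finset (Sym2 (Fin n)) :=
  Finset.univ.filter fun e => ∃ u ∈ W, ∃ v, v ∉ A ∧ e = s(u, v)

/-- The pairs between `W` and `A`. -/
def linkEdges (A W : Finset (Fin n)) : Finset (Sym2 (Fin n)) :=
  Finset.univ.filter fun e => ∃ u ∈ W, ∃ a ∈ A, e = s(u, a)

/-- The cylinder "the set of relays linked to `W` by an open edge is exactly `L`". -/
def linkEq (A W L : Finset (Fin n)) : Set (BondConfig (Fin n)) :=
  {ω | ∀ a ∈ A, (∃ u ∈ W, s(u, a) ∈ ω) ↔ a ∈ L}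

variable {A : Finset (Fin n)} {o : Fin n} {W : Finset (Fin n)} {ω : BondConfig (Fin n)}

/-- On `pocketEq`, the base vertex is in its pocket. [folklore] -/
theorem mem_of_pocketEq (hω : ω ∈ pocketEq A o W) (ho : o ∉ A) : o ∈ W :=
  (hω o).1 (openConnIn_refl (by simpa using ho))

/-- Pockets avoid the relays. [folklore] -/
theorem not_mem_of_pocketEq (hω : ω ∈ pocketEq A o W) {v : Fin n} (hv : v ∈ W) : v ∉ A := by
  obtain ⟨_, hvU, _⟩ := (hω v).2 hv
  simpa using hvU

/-- Inside its pocket `o` is joined to every pocket vertex by a path INSIDE the pocket. [folklore] -/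
theorem pocketEq_connIn (hω : ω ∈ pocketEq A o W) {v : Fin n} (hv : v ∈ W) :
    ω ∈ openConnIn (↑W : Set (Fin n)) o v := by
  classical
  obtain ⟨ho, hvU, ⟨p⟩⟩ := (hω v).2 hv
  -- every vertex of the `U`-walk is `U`-reachable from `o`, hence in `W`
  have hsupp : ∀ z ∈ p.support, (z : Fin n) ∈ W := by
    intro z hz
    exact (hω z).1 ⟨ho, z.2, ⟨p.takeUntil z hz⟩⟩
  set p' := p.map (SimpleGraph.Embedding.induce ((↑A : Set (Fin n))ᶜ)).toHom with hp'
  have hS : ∀ z ∈ p'.support, z ∈ (↑W : Set (Fin n)) := by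
    intro z hz
    rw [hp', SimpleGraph.Walk.support_map] at hz
    obtain ⟨z', hz', rfl⟩ := List.mem_map.1 hz
    exact hsupp z' hz'
  exact ⟨hS _ p'.start_mem_support, hS _ p'.end_mem_support, ⟨p'.induce _ hS⟩⟩

/-- On `pocketEq`, every `U`-edge leaving the pocket is closed. [folklore] -/
theorem closed_of_pocketEq (hω : ω ∈ pocketEq A o W) {u z : Fin n} (hu : u ∈ W) (hz : z ∉ W)
    (hzA : z ∉ A) : s(u, z) ∉ ω := by
  intro he
  have huU : u ∈ ((↑A : Set (Fin n))ᶜ) := by simpa using not_mem_of_pocketEq hω hu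
  have hzU : z ∈ ((↑A : Set (Fin n))ᶜ) := by simpa using hzA
  have hne : u ≠ z := fun h => hz (h ▸ hu)
  exact hz ((hω z).1 (PlanarDuality.openConnIn_trans ((hω u).2 hu)
    (openConnIn_of_adj huU hzU he hne)))

theorem mem_pocketEdges {e : Sym2 (Fin n)} :
    e ∈ pocketEdges A W ↔ ∃ u ∈ W, ∃ v, v ∉ A ∧ e = s(u, v) := by
  simp [pocketEdges]

theorem mem_linkEdges {e : Sym2 (Fin n)} :
    e ∈ linkEdges A W ↔ ∃ u ∈ W, ∃ a ∈ A, e = s(u, a) := by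
  simp [linkEdges]

/-- Transfer of `pocketEq` along agreement on `pocketEdges` (one direction). -/
theorem pocketEq_of_agree {ω ω' : BondConfig (Fin n)}
    (h : ω ∩ ↑(pocketEdges A W) = ω' ∩ ↑(pocketEdges A W)) (hω : ω ∈ pocketEq A o W) :
    ω' ∈ pocketEq A o W := by
  classical
  have hagree : ∀ e ∈ pocketEdges A W, e ∈ ω ↔ e ∈ ω' := fun e he =>
    ⟨fun h1 => ((Set.ext_iff.1 h e).1 ⟨h1, he⟩).1, fun h1 => ((Set.ext_iff.1 h e).2 ⟨h1, he⟩).1⟩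
  have hWU : (↑W : Set (Fin n)) ⊆ (↑A : Set (Fin n))ᶜ := fun v hv => by
    simpa using not_mem_of_pocketEq hω (Finset.mem_coe.1 hv)
  intro v
  constructor
  · -- an `U`-path of `ω'` from `o` cannot leave `W`: its first exit edge is a closed edge of `ω`
    intro hv
    by_contra hvW
    by_cases hoA : o ∈ A
    · exact absurd hv.1 (by simpa using hoA)
    have hoW : o ∈ W := mem_of_pocketEq hω hoA
    obtain ⟨u, z, hu, hz, hzU, he, -, -⟩ :=
      exists_exit (T := (↑W : Set (Fin n))) (Finset.mem_coe.2 hoW) (fun h' => hvW (Finset.mem_coe.1 h')) hv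
    have hzA : z ∉ A := by simpa using hzU
    have heP : s(u, z) ∈ pocketEdges A W :=
      mem_pocketEdges.2 ⟨u, Finset.mem_coe.1 hu, z, hzA, rfl⟩
    exact closed_of_pocketEq hω (Finset.mem_coe.1 hu) (fun h' => hz (Finset.mem_coe.2 h')) hzA
      ((hagree _ heP).2 he)
  · -- a path inside `W` in `ω` is a path inside `W` in `ω'`
    intro hvW
    have h1 := pocketEq_connIn hω hvW
    have hsub : (↑W : Set (Fin n)).sym2 ⊆ ↑(pocketEdges A W) := by
      intro e he
      induction e using Sym2.ind with
      | h x y =>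
        rw [Set.mk_mem_sym2_iff] at he
        exact Finset.mem_coe.2 (mem_pocketEdges.2 ⟨x, Finset.mem_coe.1 he.1, y,
          not_mem_of_pocketEq hω (Finset.mem_coe.1 he.2), rfl⟩)
    have hag2 : ω ∩ (↑W : Set (Fin n)).sym2 = ω' ∩ (↑W : Set (Fin n)).sym2 := by
      ext e
      simp only [Set.mem_inter_iff]
      constructor
      · rintro ⟨h1, h2⟩; exact ⟨(hagree e (hsub h2)).1 h1, h2⟩
      · rintro ⟨h1, h2⟩; exact ⟨(hagree e (hsub h2)).2 h1, h2⟩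
    have h2 : ω' ∈ openConnIn (↑W : Set (Fin n)) o v :=
      ((determinedBy_iff _ _).1 (determinedBy_openConnIn' (↑W : Set (Fin n)) o v) ω ω' hag2).1 h1
    exact openConnIn_mono' hWU o v h2

/-- **`{C_U(o) = W}` is determined by the `U`-edges touching `W`.** [folklore] -/
theorem determinedBy_pocketEq (A : Finset (Fin n)) (o : Fin n) (W : Finset (Fin n)) :
    DeterminedBy (pocketEq A o W) (↑(pocketEdges A W) : Set (Sym2 (Fin n))) := by
  rw [determinedBy_iff]
  intro ω ω' h
  exact ⟨pocketEq_of_agree h, pocketEq_of_agree h.symm⟩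

/-- The link cylinder is determined by the `W–A` pairs. [folklore] -/
theorem determinedBy_linkEq (A W L : Finset (Fin n)) :
    DeterminedBy (linkEq A W L) (↑(linkEdges A W) : Set (Sym2 (Fin n))) := by
  rw [determinedBy_iff]
  intro ω ω' h
  have hagree : ∀ e ∈ linkEdges A W, e ∈ ω ↔ e ∈ ω' := fun e he =>
    ⟨fun h1 => ((Set.ext_iff.1 h e).1 ⟨h1, he⟩).1, fun h1 => ((Set.ext_iff.1 h e).2 ⟨h1, he⟩).1⟩
  simp only [linkEq, Set.mem_setOf_eq]
  refine forall₂_congr fun a ha => ?_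
  refine iff_congr (exists_congr fun u => ?_) Iff.rfl
  refine and_congr_right fun hu => hagree _ ?_
  exact mem_linkEdges.2 ⟨u, hu, a, ha, rfl⟩

/-! ### The pocket bound and its global form -/

/-- Link cylinders over `L ⊆ A` are pairwise disjoint. -/
theorem linkEq_disjoint {A W L L' : Finset (Fin n)} (hL : L ⊆ A) (hL' : L' ⊆ A) (hne : L ≠ L') :
    Disjoint (linkEq A W L) (linkEq A W L') := by
  rw [Set.disjoint_left]
  intro ω h h'
  apply hne
  ext a
  by_cases ha : a ∈ A
  · exact (h a ha).symm.trans (h' a ha)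
  · exact ⟨fun h1 => (ha (hL h1)).elim, fun h1 => (ha (hL' h1)).elim⟩

/-- `pocketEdges` and `linkEdges` are disjoint when `W` avoids `A`. -/
theorem pocketEdges_disjoint_linkEdges {A W : Finset (Fin n)} (hWA : Disjoint W A) :
    Disjoint (pocketEdges A W) (linkEdges A W) := by
  rw [Finset.disjoint_left]
  intro e he he'
  obtain ⟨u, hu, v, hvA, rfl⟩ := mem_pocketEdges.1 he
  obtain ⟨u', hu', a, ha, heq⟩ := mem_linkEdges.1 he'
  rw [Sym2.eq_iff] at heq
  rcases heq with ⟨h1, h2⟩ | ⟨h1, h2⟩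
  · exact hvA (h2 ▸ ha)
  · exact Finset.disjoint_left.1 hWA hu (h1 ▸ ha)

/-- Pairs avoiding `W` are neither pocket nor link pairs. -/
theorem sym2_compl_subset {A W : Finset (Fin n)} :
    ((↑W : Set (Fin n))ᶜ).sym2 ⊆ (↑(pocketEdges A W ∪ linkEdges A W) : Set (Sym2 (Fin n)))ᶜ := by
  intro e he hmem
  rw [Finset.coe_union, Set.mem_union, Finset.mem_coe, Finset.mem_coe, mem_pocketEdges,
    mem_linkEdges] at hmem
  rcases hmem with ⟨u, hu, v, -, rfl⟩ | ⟨u, hu, a, -, rfl⟩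
  · exact (Set.mk_mem_sym2_iff.1 he).1 (Finset.mem_coe.2 hu)
  · exact (Set.mk_mem_sym2_iff.1 he).1 (Finset.mem_coe.2 hu)

/-- **The bad event on a pocket: some relay is linked and every linked relay fails avoiding the
pocket.** [folklore] -/
theorem pocket_bad_subset {A : Finset (Fin n)} {o : Fin n} (b : Fin n) (ho : o ∉ A)
    (W : Finset (Fin n)) :
    pocketEq A o W ∩ (⋃ a ∈ A, openConn o a) ∩ (openConn o b)ᶜ ⊆
      ⋃ L ∈ A.powerset.filter (fun L => L.Nonempty),
        (pocketEq A o W ∩ linkEq A W L ∩ ⋂ a ∈ L, (openConnIn ((↑W : Set (Fin n))ᶜ) a b)ᶜ) := by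
  classical
  rintro ω ⟨⟨hω, hA⟩, hb⟩
  set L₀ := A.filter (fun a => ∃ u ∈ W, s(u, a) ∈ ω) with hL₀
  have hlink : ω ∈ linkEq A W L₀ := by
    intro a ha
    simp [hL₀, ha]
  -- some relay is linked: the first exit out of `U` of an open path from `o` into `A`
  obtain ⟨a₀, ha₀, hoa₀⟩ := Set.mem_iUnion₂.1 hA
  have hoU : o ∈ ((↑A : Set (Fin n))ᶜ) := by simpa using ho
  have ha₀U : a₀ ∉ ((↑A : Set (Fin n))ᶜ) := by simpa using ha₀
  obtain ⟨u, z, hu, hz, -, he, -, hr⟩ :=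
    exists_exit (S := Set.univ) (T := ((↑A : Set (Fin n))ᶜ)) hoU ha₀U
      (openConnIn_univ_of_reachable' hoa₀)
  rw [Set.univ_inter] at hr
  have huW : u ∈ W := (hω u).1 hr
  have hzA : z ∈ A := by simpa using hz
  have hzL : z ∈ L₀ := by
    simp only [hL₀, Finset.mem_filter]
    exact ⟨hzA, u, huW, he⟩
  refine Set.mem_iUnion₂.2 ⟨L₀, ?_, ⟨hω, hlink⟩, ?_⟩
  · exact Finset.mem_filter.2 ⟨Finset.mem_powerset.2 (Finset.filter_subset _ _), ⟨z, hzL⟩⟩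
  · refine Set.mem_iInter₂.2 fun a ha => ?_
    intro hab
    have ha' : a ∈ A ∧ ∃ u ∈ W, s(u, a) ∈ ω := by simpa [hL₀] using ha
    obtain ⟨haA, u', hu', hua⟩ := ha'
    apply hb
    have hou : (openGraph ω).Reachable o u' := reachable_of_openConnIn' ((hω u').2 hu')
    have hu'a : u' ≠ a := fun h => (not_mem_of_pocketEq hω hu') (h ▸ haA)
    have hadj : (openGraph ω).Adj u' a := (openGraph_adj ω u' a).2 ⟨hua, hu'a⟩
    exact (hou.trans hadj.reachable).trans (reachable_of_openConnIn' hab)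

/-- **Pocket bound.** If every relay fails avoiding `W` with probability `≤ m`, then
`P(C_U(o) = W, o ↔ A, o ↮ b) ≤ m · P(C_U(o) = W)` — by the disjoint-support independence of
`{C_U(o) = W}` (pocket pairs), the link cylinders (`W–A` pairs) and `{a ↮ b avoiding W}` (pairs
avoiding `W`). [folklore] -/
theorem pocket_bad_le (w : Sym2 (Fin n) → unitInterval) {A : Finset (Fin n)} {o : Fin n}
    (b : Fin n) (ho : o ∉ A) {W : Finset (Fin n)} (hWA : Disjoint W A) {m : ℝ} (hm0 : 0 ≤ m)
    (hm : ∀ a ∈ A, (prodBernoulli w).real (openConnIn ((↑W : Set (Fin n))ᶜ) a b)ᶜ ≤ m) :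
    (prodBernoulli w).real (pocketEq A o W ∩ (⋃ a ∈ A, openConn o a) ∩ (openConn o b)ᶜ) ≤
      (prodBernoulli w).real (pocketEq A o W) * m := by
  classical
  set μ := prodBernoulli w with hμ
  set P := A.powerset.filter (fun L => L.Nonempty) with hP
  have h1 : μ.real (pocketEq A o W ∩ (⋃ a ∈ A, openConn o a) ∩ (openConn o b)ᶜ) ≤
      ∑ L ∈ P, μ.real (pocketEq A o W ∩ linkEq A W L ∩
        ⋂ a ∈ L, (openConnIn ((↑W : Set (Fin n))ᶜ) a b)ᶜ) :=
    (measureReal_mono (pocket_bad_subset b ho W) (measure_ne_top _ _)).trans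
      (measureReal_biUnion_finset_le _ _)
  have hsubU : (↑(pocketEdges A W) : Set (Sym2 (Fin n))) ⊆ ↑(pocketEdges A W ∪ linkEdges A W) := by
    rw [Finset.coe_union]; exact Set.subset_union_left
  have hsubU' : (↑(linkEdges A W) : Set (Sym2 (Fin n))) ⊆ ↑(pocketEdges A W ∪ linkEdges A W) := by
    rw [Finset.coe_union]; exact Set.subset_union_right
  have hsubC : (↑(linkEdges A W) : Set (Sym2 (Fin n))) ⊆ (↑(pocketEdges A W) : Set (Sym2 (Fin n)))ᶜ :=
    fun e he hP' => Finset.disjoint_left.1 (pocketEdges_disjoint_linkEdges hWA)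
      (Finset.mem_coe.1 hP') (Finset.mem_coe.1 he)
  have hterm : ∀ L ∈ P, μ.real (pocketEq A o W ∩ linkEq A W L ∩
      ⋂ a ∈ L, (openConnIn ((↑W : Set (Fin n))ᶜ) a b)ᶜ) ≤
        μ.real (pocketEq A o W) * μ.real (linkEq A W L) * m := by
    intro L hL
    rw [hP, Finset.mem_filter, Finset.mem_powerset] at hL
    obtain ⟨hLA, a₀, ha₀⟩ := hL
    have hmono : μ.real (pocketEq A o W ∩ linkEq A W L ∩
        ⋂ a ∈ L, (openConnIn ((↑W : Set (Fin n))ᶜ) a b)ᶜ) ≤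
          μ.real (pocketEq A o W ∩ linkEq A W L ∩ (openConnIn ((↑W : Set (Fin n))ᶜ) a₀ b)ᶜ) :=
      measureReal_mono (Set.inter_subset_inter_right _ (Set.biInter_subset_of_mem ha₀))
        (measure_ne_top _ _)
    have hind1 : μ.real (pocketEq A o W ∩ linkEq A W L ∩ (openConnIn ((↑W : Set (Fin n))ᶜ) a₀ b)ᶜ)
        = μ.real (pocketEq A o W ∩ linkEq A W L) *
            μ.real (openConnIn ((↑W : Set (Fin n))ᶜ) a₀ b)ᶜ :=
      prodBernoulli_real_inter_of_determinedBy w (pocketEdges A W ∪ linkEdges A W)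
        (((determinedBy_pocketEq A o W).mono hsubU).inter ((determinedBy_linkEq A W L).mono hsubU'))
        ((determinedBy_compl' (determinedBy_openConnIn' _ a₀ b)).mono sym2_compl_subset)
        MeasurableSet.of_discrete MeasurableSet.of_discrete
    have hind2 : μ.real (pocketEq A o W ∩ linkEq A W L) =
        μ.real (pocketEq A o W) * μ.real (linkEq A W L) :=
      prodBernoulli_real_inter_of_determinedBy w (pocketEdges A W) (determinedBy_pocketEq A o W)
        ((determinedBy_linkEq A W L).mono hsubC) MeasurableSet.of_discrete MeasurableSet.of_discrete
    calc _ ≤ _ := hmono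
      _ = μ.real (pocketEq A o W) * μ.real (linkEq A W L) *
            μ.real (openConnIn ((↑W : Set (Fin n))ᶜ) a₀ b)ᶜ := by rw [hind1, hind2]
      _ ≤ μ.real (pocketEq A o W) * μ.real (linkEq A W L) * m :=
          mul_le_mul_of_nonneg_left (hm a₀ (hLA ha₀))
            (mul_nonneg measureReal_nonneg measureReal_nonneg)
  have hsum : ∑ L ∈ P, μ.real (linkEq A W L) ≤ 1 := by
    have hdisj : Set.PairwiseDisjoint (↑P : Set (Finset (Fin n))) (linkEq A W) := by
      intro L hL L' hL' hne
      simp only [hP, Finset.coe_filter, Finset.mem_powerset, Set.mem_setOf_eq] at hL hL'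
      exact linkEq_disjoint hL.1 hL'.1 hne
    rw [← measureReal_biUnion_finset hdisj fun _ _ => MeasurableSet.of_discrete]
    exact measureReal_le_one
  calc _ ≤ _ := h1
    _ ≤ ∑ L ∈ P, μ.real (pocketEq A o W) * μ.real (linkEq A W L) * m := Finset.sum_le_sum hterm
    _ = μ.real (pocketEq A o W) * m * ∑ L ∈ P, μ.real (linkEq A W L) := by
        rw [Finset.mul_sum]
        exact Finset.sum_congr rfl fun L _ => by ring
    _ ≤ μ.real (pocketEq A o W) * m * 1 :=
        mul_le_mul_of_nonneg_left hsum (mul_nonneg measureReal_nonneg hm0)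
    _ = (prodBernoulli w).real (pocketEq A o W) * m := by rw [mul_one]

/-- **Pocket bound × Harris deletion (C7 kernel).**
`P(C_U(o) = W, o ↔ A, o ↮ b) · P(W ↮ b) ≤ δ · P(C_U(o) = W)` whenever every relay is
`δ`-reliable: bad mass on a relay-free pocket is paid for by the pocket's OWN unreliability as a
set. [folklore] -/
theorem pocket_bad_mul_le (w : Sym2 (Fin n) → unitInterval) {A : Finset (Fin n)} {o : Fin n}
    (b : Fin n) (ho : o ∉ A) {W : Finset (Fin n)} (hWA : Disjoint W A) {t : ℝ} (ht0 : 0 ≤ t)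
    (ht : ∀ a ∈ A, (prodBernoulli w).real (openConn a b)ᶜ ≤ t) :
    (prodBernoulli w).real (pocketEq A o W ∩ (⋃ a ∈ A, openConn o a) ∩ (openConn o b)ᶜ) *
        (prodBernoulli w).real (⋃ x ∈ W, openConn x b)ᶜ ≤
      (prodBernoulli w).real (pocketEq A o W) * t := by
  set ρ := (prodBernoulli w).real (⋃ x ∈ W, openConn x b)ᶜ with hρ
  have hρ0 : 0 ≤ ρ := measureReal_nonneg
  rcases hρ0.eq_or_lt with h0 | hpos
  · rw [← h0, mul_zero]
    exact mul_nonneg measureReal_nonneg ht0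
  · have hm : ∀ a ∈ A, (prodBernoulli w).real (openConnIn ((↑W : Set (Fin n))ᶜ) a b)ᶜ ≤ t / ρ := by
      intro a ha
      rw [le_div_iff₀ hpos]
      exact (real_openConnIn_compl_mul_le w W a b).trans (ht a ha)
    have key := pocket_bad_le w b ho hWA (div_nonneg ht0 hpos.le) hm
    calc _ ≤ (prodBernoulli w).real (pocketEq A o W) * (t / ρ) * ρ :=
          mul_le_mul_of_nonneg_right key hpos.le
      _ = (prodBernoulli w).real (pocketEq A o W) * t := by
          rw [mul_assoc, div_mul_cancel₀ t hpos.ne']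

/-- The relay-free pocket of a configuration, as a finset. -/
noncomputable def pocketOf (A : Finset (Fin n)) (o : Fin n) (ω : BondConfig (Fin n)) :
    Finset (Fin n) := by
  classical
  exact Finset.univ.filter fun v => ω ∈ uConn A o v

theorem mem_pocketOf {A : Finset (Fin n)} {o : Fin n} {ω : BondConfig (Fin n)} {v : Fin n} :
    v ∈ pocketOf A o ω ↔ ω ∈ uConn A o v := by
  classical
  simp [pocketOf]

theorem mem_pocketEq_pocketOf (A : Finset (Fin n)) (o : Fin n) (ω : BondConfig (Fin n)) :
    ω ∈ pocketEq A o (pocketOf A o ω) := fun _ => mem_pocketOf.symm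

theorem pocketOf_disjoint (A : Finset (Fin n)) (o : Fin n) (ω : BondConfig (Fin n)) :
    Disjoint (pocketOf A o ω) A := by
  rw [Finset.disjoint_left]
  intro v hv hvA
  have h := (mem_pocketOf.1 hv).2.1
  exact h (Finset.mem_coe.2 hvA)

theorem pocketEq_disjoint {A : Finset (Fin n)} {o : Fin n} {W W' : Finset (Fin n)} (hne : W ≠ W') :
    Disjoint (pocketEq A o W) (pocketEq A o W') := by
  rw [Set.disjoint_left]
  intro ω h h'
  exact hne (Finset.ext fun v => (h v).symm.trans (h' v))

/-- **The bad event lives on reliable relay-free pockets (C7).** For every threshold `r > 0`: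
`P(o ↔ A, o ↮ b, P(C_U(o) ↮ b) ≥ r) ≤ δ / r` (sum `pocket_bad_mul_le` over the partition into
pockets).  With `r = 2δ/ε`: at least `P(bad) − ε/2` of the bad event sits on configurations
whose relay-free pocket is a `(2δ/ε)`-reliable SET — the formal content of §6's proof direction.
[folklore] -/
theorem bad_unreliablePocket_le (w : Sym2 (Fin n) → unitInterval) (A : Finset (Fin n))
    (o b : Fin n) (ho : o ∉ A) {t r : ℝ} (ht0 : 0 ≤ t) (hr : 0 < r)
    (ht : ∀ a ∈ A, (prodBernoulli w).real (openConn a b)ᶜ ≤ t) :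
    (prodBernoulli w).real ((⋃ a ∈ A, openConn o a) ∩ (openConn o b)ᶜ ∩
      {ω | r ≤ (prodBernoulli w).real (⋃ x ∈ pocketOf A o ω, openConn x b)ᶜ}) ≤ t / r := by
  classical
  set μ := prodBernoulli w with hμ
  set 𝒲 := (Finset.univ : Finset (Finset (Fin n))).filter
    (fun W => Disjoint W A ∧ r ≤ μ.real (⋃ x ∈ W, openConn x b)ᶜ) with h𝒲
  have hcover : (⋃ a ∈ A, openConn o a) ∩ (openConn o b)ᶜ ∩
      {ω | r ≤ μ.real (⋃ x ∈ pocketOf A o ω, openConn x b)ᶜ} ⊆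
        ⋃ W ∈ 𝒲, (pocketEq A o W ∩ (⋃ a ∈ A, openConn o a) ∩ (openConn o b)ᶜ) := by
    rintro ω ⟨⟨hA, hb⟩, hrel⟩
    refine Set.mem_iUnion₂.2 ⟨pocketOf A o ω, ?_, ⟨mem_pocketEq_pocketOf A o ω, hA⟩, hb⟩
    rw [h𝒲, Finset.mem_filter]
    exact ⟨Finset.mem_univ _, pocketOf_disjoint A o ω, hrel⟩
  have hterm : ∀ W ∈ 𝒲, μ.real (pocketEq A o W ∩ (⋃ a ∈ A, openConn o a) ∩ (openConn o b)ᶜ) ≤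
      μ.real (pocketEq A o W) * (t / r) := by
    intro W hW
    rw [h𝒲, Finset.mem_filter] at hW
    obtain ⟨-, hWA, hrW⟩ := hW
    have key := pocket_bad_mul_le w b ho hWA ht0 ht
    rw [← mul_div_assoc, le_div_iff₀ hr]
    calc μ.real (pocketEq A o W ∩ (⋃ a ∈ A, openConn o a) ∩ (openConn o b)ᶜ) * r
        ≤ μ.real (pocketEq A o W ∩ (⋃ a ∈ A, openConn o a) ∩ (openConn o b)ᶜ) *
            μ.real (⋃ x ∈ W, openConn x b)ᶜ :=
          mul_le_mul_of_nonneg_left hrW measureReal_nonneg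
      _ ≤ μ.real (pocketEq A o W) * t := key
  have hsum : ∑ W ∈ 𝒲, μ.real (pocketEq A o W) ≤ 1 := by
    have hdisj : Set.PairwiseDisjoint (↑𝒲 : Set (Finset (Fin n))) (pocketEq A o) :=
      fun W _ W' _ hne => pocketEq_disjoint hne
    rw [← measureReal_biUnion_finset hdisj fun _ _ => MeasurableSet.of_discrete]
    exact measureReal_le_one
  calc _ ≤ μ.real (⋃ W ∈ 𝒲, (pocketEq A o W ∩ (⋃ a ∈ A, openConn o a) ∩ (openConn o b)ᶜ)) :=
        measureReal_mono hcover (measure_ne_top _ _)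
    _ ≤ ∑ W ∈ 𝒲, μ.real (pocketEq A o W ∩ (⋃ a ∈ A, openConn o a) ∩ (openConn o b)ᶜ) :=
        measureReal_biUnion_finset_le _ _
    _ ≤ ∑ W ∈ 𝒲, μ.real (pocketEq A o W) * (t / r) := Finset.sum_le_sum hterm
    _ = (∑ W ∈ 𝒲, μ.real (pocketEq A o W)) * (t / r) := by rw [Finset.sum_mul]
    _ ≤ 1 * (t / r) := mul_le_mul_of_nonneg_right hsum (div_nonneg ht0 hr.le)
    _ = t / r := one_mul _

/-! ### Entropy form: `P(bad) ≤ √δ · Σ_W √P(C_U(o) = W)` -/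

/-- On its pocket event, `o ↮ b` forces the whole pocket to miss `b`. [folklore] -/
theorem pocketEq_notConn_subset {A : Finset (Fin n)} {o : Fin n} (b : Fin n) (W : Finset (Fin n)) :
    pocketEq A o W ∩ (openConn o b)ᶜ ⊆ (⋃ x ∈ W, (openConn x b : Set (BondConfig (Fin n))))ᶜ := by
  rintro ω ⟨hω, hb⟩ hU
  obtain ⟨x, hx, hxb⟩ := Set.mem_iUnion₂.1 hU
  exact hb ((reachable_of_openConnIn' ((hω x).2 hx)).trans hxb)

/-- A pocket meeting `A` never occurs. [folklore] -/
theorem pocketEq_eq_empty_of_not_disjoint {A : Finset (Fin n)} {o : Fin n} {W : Finset (Fin n)}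
    (h : ¬ Disjoint W A) : pocketEq A o W = ∅ := by
  ext ω
  simp only [Set.mem_empty_iff_false, iff_false]
  intro hω
  exact h (Finset.disjoint_left.2 fun v hv => not_mem_of_pocketEq hω hv)

/-- **Square-root pocket bound.** `P(C_U(o) = W, o ↔ A, o ↮ b) ≤ √(δ · P(C_U(o) = W))`:
the bad mass `x` on a pocket satisfies both `x · ρ_W ≤ δ · P(C_U(o) = W)` (`pocket_bad_mul_le`)
and `x ≤ ρ_W` (`pocketEq_notConn_subset`), `ρ_W = P(W ↮ b)`. [folklore] -/
theorem pocket_bad_le_sqrt (w : Sym2 (Fin n) → unitInterval) {A : Finset (Fin n)} {o : Fin n}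
    (b : Fin n) (ho : o ∉ A) (W : Finset (Fin n)) {t : ℝ} (ht0 : 0 ≤ t)
    (ht : ∀ a ∈ A, (prodBernoulli w).real (openConn a b)ᶜ ≤ t) :
    (prodBernoulli w).real (pocketEq A o W ∩ (⋃ a ∈ A, openConn o a) ∩ (openConn o b)ᶜ) ≤
      Real.sqrt (t * (prodBernoulli w).real (pocketEq A o W)) := by
  set μ := prodBernoulli w with hμ
  set x := μ.real (pocketEq A o W ∩ (⋃ a ∈ A, openConn o a) ∩ (openConn o b)ᶜ) with hx
  have hx0 : 0 ≤ x := measureReal_nonneg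
  by_cases hWA : Disjoint W A
  · have h1 := pocket_bad_mul_le w b ho hWA ht0 ht
    have h2 : x ≤ μ.real (⋃ y ∈ W, openConn y b)ᶜ := by
      refine measureReal_mono ?_ (measure_ne_top _ _)
      rintro ω ⟨⟨hω, -⟩, hb⟩
      exact pocketEq_notConn_subset b W ⟨hω, hb⟩
    refine Real.le_sqrt_of_sq_le ?_
    calc x ^ 2 = x * x := sq x
      _ ≤ x * μ.real (⋃ y ∈ W, openConn y b)ᶜ := mul_le_mul_of_nonneg_left h2 hx0
      _ ≤ μ.real (pocketEq A o W) * t := h1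
      _ = t * μ.real (pocketEq A o W) := mul_comm _ _
  · have h0 : x = 0 := by
      rw [hx, pocketEq_eq_empty_of_not_disjoint hWA, Set.empty_inter, Set.empty_inter,
        measureReal_empty]
    rw [h0]
    exact Real.sqrt_nonneg _

/-- **Entropy bound (Rényi-½ form).** `P(o ↔ A, o ↮ b) ≤ Σ_W √(δ · P(C_U(o) = W))`
`= √δ · exp(H_{1/2}(C_U(o)) / 2)`: Kozma–Nitzan's Conjecture 3 can fail only through relay-free
pockets whose law has Rényi-½ entropy `≥ log(ε²/δ)`; by Cauchy–Schwarz a counterexample at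
`(ε, δ)` needs at least `ε²/δ` distinct realizable relay-free pockets around `o`. [folklore] -/
theorem bad_le_sum_sqrt (w : Sym2 (Fin n) → unitInterval) (A : Finset (Fin n)) (o b : Fin n)
    (ho : o ∉ A) {t : ℝ} (ht0 : 0 ≤ t) (ht : ∀ a ∈ A, (prodBernoulli w).real (openConn a b)ᶜ ≤ t) :
    (prodBernoulli w).real ((⋃ a ∈ A, openConn o a) ∩ (openConn o b)ᶜ) ≤
      ∑ W : Finset (Fin n), Real.sqrt (t * (prodBernoulli w).real (pocketEq A o W)) := by
  classical
  set μ := prodBernoulli w with hμ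
  have hcover : (⋃ a ∈ A, openConn o a) ∩ (openConn o b)ᶜ ⊆
      ⋃ W ∈ (Finset.univ : Finset (Finset (Fin n))),
        (pocketEq A o W ∩ (⋃ a ∈ A, openConn o a) ∩ (openConn o b)ᶜ) := by
    rintro ω ⟨hA, hb⟩
    exact Set.mem_iUnion₂.2 ⟨pocketOf A o ω, Finset.mem_univ _,
      ⟨mem_pocketEq_pocketOf A o ω, hA⟩, hb⟩
  calc _ ≤ μ.real (⋃ W ∈ (Finset.univ : Finset (Finset (Fin n))),
        (pocketEq A o W ∩ (⋃ a ∈ A, openConn o a) ∩ (openConn o b)ᶜ)) :=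
        measureReal_mono hcover (measure_ne_top _ _)
    _ ≤ ∑ W : Finset (Fin n), μ.real (pocketEq A o W ∩ (⋃ a ∈ A, openConn o a) ∩ (openConn o b)ᶜ) :=
        measureReal_biUnion_finset_le _ _
    _ ≤ _ := Finset.sum_le_sum fun W _ => pocket_bad_le_sqrt w b ho W ht0 ht

/-- **Counting form.** `P(o ↔ A, o ↮ b)² ≤ δ · #{W : P(C_U(o) = W) ≠ 0}`. [folklore] -/
theorem bad_sq_le_card_support (w : Sym2 (Fin n) → unitInterval) (A : Finset (Fin n)) (o b : Fin n)
    (ho : o ∉ A) {t : ℝ} (ht0 : 0 ≤ t) (ht : ∀ a ∈ A, (prodBernoulli w).real (openConn a b)ᶜ ≤ t) :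
    (prodBernoulli w).real ((⋃ a ∈ A, openConn o a) ∩ (openConn o b)ᶜ) ^ 2 ≤
      t * ((Finset.univ : Finset (Finset (Fin n))).filter
        (fun W => (prodBernoulli w).real (pocketEq A o W) ≠ 0)).card := by
  classical
  set μ := prodBernoulli w with hμ
  set S := (Finset.univ : Finset (Finset (Fin n))).filter (fun W => μ.real (pocketEq A o W) ≠ 0)
    with hS
  have h1 := bad_le_sum_sqrt w A o b ho ht0 ht
  -- terms outside the support vanish
  have h2 : ∑ W : Finset (Fin n), Real.sqrt (t * μ.real (pocketEq A o W)) =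
      ∑ W ∈ S, Real.sqrt (t * μ.real (pocketEq A o W)) := by
    rw [hS, Finset.sum_filter]
    refine Finset.sum_congr rfl fun W _ => ?_
    by_cases h : μ.real (pocketEq A o W) = 0
    · simp [h]
    · simp [h]
  -- Cauchy–Schwarz with the constant function 1
  have h3 : (∑ W ∈ S, Real.sqrt (t * μ.real (pocketEq A o W))) ^ 2 ≤
      S.card * ∑ W ∈ S, (Real.sqrt (t * μ.real (pocketEq A o W))) ^ 2 := by
    have := Finset.sum_mul_sq_le_sq_mul_sq S (fun _ => (1 : ℝ))
      (fun W => Real.sqrt (t * μ.real (pocketEq A o W)))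
    simpa using this
  have h4 : ∑ W ∈ S, (Real.sqrt (t * μ.real (pocketEq A o W))) ^ 2 ≤ t := by
    have hdisj : Set.PairwiseDisjoint (↑S : Set (Finset (Fin n))) (pocketEq A o) :=
      fun W _ W' _ hne => pocketEq_disjoint hne
    calc ∑ W ∈ S, (Real.sqrt (t * μ.real (pocketEq A o W))) ^ 2
        = ∑ W ∈ S, t * μ.real (pocketEq A o W) :=
          Finset.sum_congr rfl fun W _ => Real.sq_sqrt (mul_nonneg ht0 measureReal_nonneg)
      _ = t * ∑ W ∈ S, μ.real (pocketEq A o W) := by rw [Finset.mul_sum]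
      _ ≤ t * 1 := by
          refine mul_le_mul_of_nonneg_left ?_ ht0
          rw [← measureReal_biUnion_finset hdisj fun _ _ => MeasurableSet.of_discrete]
          exact measureReal_le_one
      _ = t := mul_one t
  have h0 : 0 ≤ μ.real ((⋃ a ∈ A, openConn o a) ∩ (openConn o b)ᶜ) := measureReal_nonneg
  calc μ.real ((⋃ a ∈ A, openConn o a) ∩ (openConn o b)ᶜ) ^ 2
      ≤ (∑ W ∈ S, Real.sqrt (t * μ.real (pocketEq A o W))) ^ 2 := by
        rw [← h2]; exact pow_le_pow_left₀ h0 h1 2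
    _ ≤ S.card * ∑ W ∈ S, (Real.sqrt (t * μ.real (pocketEq A o W))) ^ 2 := h3
    _ ≤ S.card * t := mul_le_mul_of_nonneg_left h4 (Nat.cast_nonneg _)
    _ = t * S.card := mul_comm _ _

end Pocket

/-! ## §6 Why it resists — anatomy of a would-be counterexample (informal; by hand, 2026-08-15)

Notation: `q_a = P(o ↔ a)`, `N = |C(o) ∩ A|`, `E N = Σ_a q_a`, bad event
`B = {o ↮ b} ∩ {o ↔ A} = {C(o) ∌ b, C(o) ∩ A ≠ ∅}`; hypotheses `P(o ↮ A) ≤ δ`,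
`P(a ↮ b) ≤ δ ∀ a`; goal of the adversary: `P(o ↮ b) ≥ ε` with `δ → 0`.

(C1) `P(B) ≤ δ · E N` (§4).  (C2) thinning (kn card, step 1): for every `ρ ∈ (0,1]`,
`P(o ↮ b) ≤ E[(1-ρ)^N] + ρ δ E N`; with `ρ = ε/(2 δ E N)` a counterexample needs
`P(1 ≤ N ≤ 4 δ E N / ε) ≥ ε/4`: conditionally on `B`, `o` meets `A` in a vanishing FRACTION
`O(δ/ε)` of its mean number of relays.  (C3) pockets: `B = ⊔_C {C(o) = C}` over connected
`C ∋ o`, `b ∉ C`, `C ∩ A ≠ ∅`; for each `a`, `Σ_{C ∋ a} P(C(o) = C) ≤ P(a ↮ b) ≤ δ`, so the bad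
mass `≥ ε - δ` is spread over relays each carrying `≤ δ`: at least `(ε-δ)/δ` relays, and given `B`
every FIXED relay is in the pocket with probability `≤ δ/(ε-δ)`.  (C4) for a fixed reached set
`R₀ ∋ a₀`, `P(reached = R₀, all of R₀ fail) ≤ δ`: the reached set must take `≥ ε/δ` distinct
values on `B` — high entropy of `C(o) ∩ A` is necessary.  (C5) if the failures `{a ↮ b}` are
driven by edges disjoint from those deciding `o`'s access (independent sub-gadgets), then
`P(o ↮ b) ≤ P(reached = ∅) + max_a P(a fails) ≤ 2δ`: access and failure MUST share edges, yet for
each fixed `a` Harris forces `P(o ↔ a | a ↮ b) ≤ q_a`.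

Families killed by hand (each satisfies the crux with the displayed loss):
* star / `K_{1,M}` relays with private lines to `b`; hub families (all relays tied to one hub);
  chains `b – a₁ – ⋯ – a_M` with `o` attached anywhere; spines with `o` attached to many spine
  vertices: `P(o ↮ b) ≤ 2δ` up to `(1+o(1))` (C5 or "lowest reached index" argument).
* spherically symmetric trees rooted at `o`, leaves wired to `b`, relays = internal vertices:
  `P(o ↮ b) ≤ (δ^{1/k} + δ)^k ≤ 2δ` (`k` = root degree; independent subtrees = C5).
* `K_{2,M}` plus one hub `h` (petal = relay `a_i` with edges to `o`, `h`, `b` of weights `x,y,z`):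
  case `z ≥ 1/2` forces `v = w(o,h) ≥ 1 - δ/ε²` and then `P(o ↮ b) ≤ δ/ε² + √δ/ε`; case `z < 1/2`
  forces `y ≥ 1 - 4δ/ε` (all relays ≡ `h`, bounded effective `|A|`): `P(o ↮ b) ≤ 2δ + 4δ/ε`.
* disjoint petals / tentacles glued only at `o` (petal `i` reached through a link closed w.p.
  `t_i`, outer moat closed w.p. `u_i`): reliability of a relay in petal `i` gives
  `u_i · max(t_i, ε) ≲ 2δ` (Harris on two decreasing events), whence
  `P(B) ≲ 2δ Σ_i (∏_{j≠i} t_j)(1-t_i)/max(t_i, ε) = O(δ log(1/T))`, `T = ∏ t_j = P(o ↮ A)`;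
  making `T` tiny only multiplies independent failure requirements.  Dead.
* near-sure media (all weights `1-η`, `o` ordinary or weaker): `P(o ↮ b) = η^{deg}(1+O(η))`
  equals the relay failure rate: `o` is not special enough; making `o`'s edges weaker violates
  `P(o ↮ A) ≤ δ`.
* ghost-field reliability (every relay has a private line to `b` of weight `y`): reduces to
  cluster-size statistics `P(a ↮ b) = E[(1-y)^{|C'(a)|}]`; needs `o`'s cluster small
  (`≤ s`) w.p. `ε` yet containing a relay w.h.p., while relays have clusters `≥ s log(2/δ)` w.p.
  `1-δ/2`; the recursion `f(v) ≤ P(v isolated) + Σ_u w(v,u) f(u)` for `f(v) = P(|C(v)| ≤ s)`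
  (Harris) pushes the smallness of `o`'s cluster onto non-relay buffer vertices, and every
  buffer layer between `o` and the relays re-creates case C5.  No construction found.

Exploration constraints (C6–C8; C8 and the depth-one case are formal in §7).  Let `U = V ∖ A`
(WLOG `A = A* :=` all `δ`-reliable vertices — enlarging `A` keeps both hypotheses — so every
`u ∈ U` has `P(u ↮ b) > δ`), and let `W = C_U(o)` be the cluster of `o` using non-relays only
(fully explored: `U`-edges at `W` revealed, everything else fresh).  Given `W` and the set `L`
of relays linked to `W` by an open edge, `o ↔ b ⟺ L ↔ b in G − W` (fresh percolation).  Hence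
(C6) `P(o ↮ b) = E[τ_W] + E[Σ_{L≠∅} π_W(L) P_{G−W}(L ↮ b)]` with `E[τ_W] = P(o ↮ A) ≤ δ`;
(C8, Harris on two decreasing events) `P_{G−W}(L ↮ b) · P_G(W ↮ b) ≤ P_G(L ↮ b) ≤ δ`; so
(C7) `P(o ↮ b) ≤ δ + E[min(1, δ / ρ(C_U(o)))]`, `ρ(W) := P_G(W ↮ b)`: on at least `ε/2 − δ` of
the space the relay-free pocket `C_U(o)` is a `(2δ/ε)`-RELIABLE SET (`ρ ≤ 2δ/ε`) which is
nevertheless cut from `b`; since `P(C_U(o) = W, o ↮ b) ≤ ρ(W)`, at least `≈ ε²/(4δ)` distinct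
reliable relay-free pockets around `o` must each occur as THE pocket with probability `≈ δ/ε`.
With `W = {o}` (depth one) this is contradictory (`ρ({o}) = P(o ↮ b) ≥ ε`): theorem
`nearOneGluing_depth_one`.  PROOF DIRECTION this suggests (for provers): if the events
`{C_U(o) = W}` were increasing, Harris would finish (`Σ_W P(C_U(o)=W) ρ(W) ≤ 2δ/ε`); they are
not (closed `U`-boundary), and the missing estimate is an entropy bound for reliable pockets —
exactly the "finger/boundary entropy" residual of the kn-near-one-gluing card, now localised to
relay-FREE pockets.  A stopping-time variant (grow `C_U(o)` vertex by vertex, stop when the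
explored set first becomes `(2δ/ε)`-reliable) reduces the crux to: `Σ_W P(W_T = W) · ρ(W | closed
revealed boundary)` small; the obstruction is only the conditioning on the revealed closed edges.

FORMAL STATUS (§9): the kernel of this programme is now checked — `pocket_bad_mul_le`,
`bad_unreliablePocket_le`, and the entropy forms `bad_le_sum_sqrt` / `bad_sq_le_card_support`
(`P(bad) ≤ √δ · Σ_W √P(C_U(o) = W)`).  One further (unformalised) refinement: `{C_U(o) = W} =
I_W ∩ D_W` with `I_W = {W ⊆ C_U(o)}` increasing (pairs inside `W`) and `D_W = {∂_U W closed}`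
decreasing (boundary pairs), independent; Harris then gives `P(C_U(o) = W, bad) ≤ P(I_W) ·
min(ρ_W, δ P(D_W)/ρ_W) ≤ P(I_W) √(δ P(D_W))`, i.e. `P(bad) ≤ √δ · Σ_W P(I_W) √P(D_W)` — the
crux would follow from `Σ_W P(I_W) √P(D_W) = O(1)` uniformly, which is FALSE in general (dense
reliable media have exponentially many internally-spanned `W` with tiny `P(D_W)`), so the last
step must use that such media are not bad at all: the missing inequality couples the entropy of
near-spanned pockets to the reliability budget, and is witness-level (BK/OSSS), as the bhk card
also concludes.

What a counterexample would have to look like (for the next adversary): depth ≥ 2 (a buffer of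
individually unreliable non-relays around `o`), a HIGH-ENTROPY family of relay-free pockets
`W ∋ o` (≥ ε²/4δ of them), each reliable AS A SET (`P(W ↔ b) ≥ 1 − 2δ/ε`, necessarily through
relays adjacent to `W`, since relays are `(δ/ε)`-reliable in `G − o` but the linked relays must
be unreliable in `G − W`), each occurring as `C_U(o)` with probability `≈ δ/ε` jointly with its
closed boundary.  Geometric media fail (too few directions near `o`: a moat enclosing `o` and
one of `M` adjacent regions has length `≳ M`); mean-field media fail (the finite cluster of `o`
is too small to find the `e^{-c(D-d)}`-rare failed hubs); near-critical planar media fail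
(relays = sites are unreliable at `p < 1`, hubs inside closed circuits are cut at every scale).
The bunkbed counterexample style (Hollom / Gladkov–Pak–Zimin 2024: a 3-uniform-hypergraph gadget
simulated by dense graphs) is the one untested direction: it produces non-FKG-like correlations
between connection events of different vertex pairs, which is what (C5) asks for; but all of
C1–C8 hold verbatim for hypergraph percolation (product measure, increasing connection events),
and it attacks an inequality with slack `0`, whereas here the required gain is a factor
`ε/δ → ∞`.  Kit jobs j005349 (pairs + triples on `K_n`, `n ≤ 7`) and j005066 (pairs, `n ≤ 9`)
test the exact inequalities (AdditiveGluing, KN Conj 1/2) where a single hypergraph/graph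
witness would count.
-/

/-! ## Targets — the lead's STUCK stubs (HANDOFF 2026-08-16T02:05Z: `stub_doomWindow`, `stub_giantPocketsRare`)

* `stub_doomWindow` (Lines/bhk-dyadic-thinning.lean) is EQUIVALENT to the crux given the landed stubs
  (`nearOneGluing_iff_doomWindow` in the skeleton): no separate attack exists; everything in §2–§9 applies verbatim.
* `stub_giantPocketsRare` (Lines/independent-bad-world.lean; goal: `∃ j C κ > 0, ∀ instances at level δ,
  u^j · P(o ↮ b ∧ u^j ≤ 2 N δ^j) ≤ C δ^κ`, `u = P(o ↮ b)`, `N = |C(o) ∩ A|`) is a POWER-RATE form of the crux: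
  (⇐) AdditiveGluing ⇒ it with `j = 0, C = 2, κ = 1`; power-rate NearOneGluing (`P(o ↮ b) ≤ C δ^κ`) ⇒ it with `j = 0`;
  (⇒) with the landed `multiCopyFootprint` (bad mass with `N < ½(u/δ)^j` is `≤ δ/((1-θ)u^j)`) and `u ≤ δ + P(bad)`:
  `u^{j+1} ≤ 3δ + C δ^κ`, i.e. `P(o ↮ b) ≤ (3δ + Cδ^κ)^{1/(j+1)}` — power-rate NearOneGluing.
  KILL CRITERION therefore: a family with the hypotheses at level `δ → 0` and `P(o ↮ b) ≥ δ^{o(1)}` (decay slower than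
  every power), e.g. `P(o ↮ b) ≍ 1/log(1/δ)`; by logGluing this needs `log₂|A| ≳ 1/(16 δ^{1-o(1)})`, and it would make the
  gluing ratio `F = P(o ↮ b)/(P(o ↮ A) + max_a P(a ↮ b))` unbounded — refuting AdditiveGluing (stmt-4576) and KN
  Conjecture 1 on the way.  STATUS: NOT BROKEN.  Evidence against a kill with the present arsenal: every weighted `K_n`,
  `n ≤ 7` (local Adam ascent on exact partition-DP probabilities, objectives F, AdditiveGluing slack, KN ratios R1, R2;
  graphs and 3-uniform hypergraphs for `n ≤ 6`; kit smoke j005065 L-BFGS-B `n ≤ 6`) has `sup F = 1`, attained only on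
  the two degenerate equality loci (`o` merged into the relay blob; relay blob merged into `b`); every hand family of §6
  has `F = O(1)`; the triage/ideator exact enumerations (`n ≤ 6`, all `2^{|E|}` configurations) report 0 AdditiveGluing
  violations.  A refutation of this stub is thus at least as hard as an `F → ∞` family, for which §6 + BarrierSharedBit
  give the specification (simulate shared bits without sharing connectivity) and BK gives the obstruction.
-/

end Summit.CriticalPhenomena.PercolationContinuityZ3.Cruxes.NearOneGluing.Disproof
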